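import Literature.MathematicalPhysics.QuantumFieldTheory.Balaban1983to89.B12Schur433

/-!
# Bałaban CMP 109 (1987) §4 p. 284 and pp. 286–287: (4.7) ⇒ (4.12) AT `B = 0` — the THIRD Ward–Takahashi identity
(4.15)₃ «⟨(δ⁴/δB⁴)𝐄(1), B₁,B₂,B₃, ∂λ⟩ − ⟨(δ³/δB³)𝐄(1), B₁,B₂, i[λ₋,B₃] − ½i[B₃,∂λ]⟩ − (B₃↔B₂) − (B₃↔B₁) +
⟨(δ²/δB²)𝐄(1), B₁, k₂{iad_{B₂}, iad_{B₃}}∂λ⟩ + (B₁↔B₂) + (B₁↔B₃) = 0» AT `B = 0` IN THE CHART `V = exp iB` OF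
`𝔤`-VALUED GAUGE FIELDS (print's `k₂ = 1/12` confirmed; NO (4.14), NO semisimplicity needed: the next coefficient of
`g⁻¹` is `0`), and the pointwise form of its corollary (4.24) of p. 287 with print's coefficients `2, 1, −2, −2`

CITATION HEADER (lean-in-tree rule 2026-08-18).
* Source: T. Bałaban, "Renormalization group approach to lattice gauge field theories. I. Generation of effective
  actions in a small field approximation and a coupling constant renormalization in four dimensions", Commun. Math.
  Phys. **109** (1987) 249–301, doi:10.1007/bf01215223 [Balaban1987RG1] (cell paper B12; held:
  `paper:balaban1987-cmp109-rg-i-small-field`; PDF page = journal page − 248), §4 p. 284, displays (4.12), (4.15),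
  and pp. 286–287, the sentences around display (4.24).  The sentences and displays of pp. 284, 286 and 287 quoted
  below were READ AS IMAGES by the author of this file on the 300-dpi renders of the audit cell
  (`HOME/b2b-balaban-ref1/pages/1987-cmp109-rg-I-small-field/…-p036-x2.png` = p. 284, `…-p038-x2.png` = p. 286,
  `…-p039-x2.png` = p. 287; HOME = the cell folder `run/shared/lean/pub/pub-balaban/`); (4.7) of p. 282 and
  (4.8)–(4.11) of p. 283 are quoted as in the headers of the lineage's `…B12GaugeInv47` / `…B12WardSecond415` (whose
  authors read `…-p034-x2.png`, `…-p035-x2.png`), and all agree with the lineage transcript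
  `HOME/b2b-balaban-b03/B12s-transcript.md`; inside quotation marks nothing is altered.  Audit cell `pub-balaban`,
  unit `b2b-balaban-b03-g24` (PAPER SUB-CELL B03 → B12 §§2–5 lineage, gen 24), node B12-WARD-THIRD-415.  Imports only
  the lineage's own accepted module `…B12Schur433` (gen 23: the Schur step of p. 289; used here by name only through
  `hessian_chart_symm`, the symmetry of the chart Hessian at `0`); through it `…B12WardSecond415` (gen 22: the chart
  calculus to third order `fderiv_fderiv_fderiv_chart_zero_apply`, the third-order chain rule
  `fderiv_fderiv_fderiv_comp_apply`, `…_comp_chart_zero_apply`, (4.7) ⇒ (4.11) at `B = 0` `third_one_apply_grad_eq`,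
  the pointwise identity `gen_add_jordan_eq_commutator_sub`, `sum_perm_fin_three`), `…B12Semisimple414` (gen 21: the
  chart `chart_zero`, `contDiff_chart`, `fderiv_chart_zero_apply`, `fderiv_fderiv_chart_zero_apply`,
  `fderiv_fderiv_comp_chart_zero_apply`, (4.7) ⇒ (4.10) at `B = 0` `hessian_one_apply_grad_eq`), `…B12GaugeInv47`
  (gen 20: (4.7) ⇒ (4.9) `fderiv_apply_gaugeGenerator_eq_zero`, `exists_generatorCLM`) and `…B12Ward414` (gen 5: the
  abstract third-order Ward identity `ward_third_order`, the calculus helpers `fderiv_eval_along`,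
  `fderiv_eval_const`) and Mathlib's `NormedSpace.exp`, `expSeries`, `Equiv.Perm.decomposeFin`,
  `ContDiffAt.isSymmSndFDerivAt`; modifies nothing.
* Statements reproduced (verbatim).  p. 283 [PDF 35] (as quoted by the parent): (4.8) *"[…] (1/i) log V^v(b) = […]
  = B(b) + i[λ(b₋), B(b)] − g⁻¹(iad_{B(b)})(δλ)(b) + … [sic: (δλ)(b) = (∂λ)(b) of (4.9)], where the dots denote terms
  of higher order in λ, and g⁻¹(z) = (−z)/(e^{−z} − 1) = 1 + ½z + k₂z² + …."*; *"From this we derive a whole sequence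
  of identities by differentiations with respect to B. For our purpose it is enough to consider expressions with
  four derivatives at most."*; (4.10) *"[…] where {A, B} = AB + BA;"*.  p. 284 [PDF 36]: *"where the symbol (B₁↔B₂)
  denotes an expression obtained from the preceding one by the exchange of B₁ with B₂;"* (4.12) *"⟨(δ⁴/δB⁴)𝐄(exp
  iB), iad_{λ₋}B − g⁻¹(iad_B)∂λ, B₁,B₂,B₃⟩ + ⟨(δ³/δB³)𝐄(exp iB), iad_{λ₋}B₃ − ½iad_{B₃}∂λ − k₂{iad_{B₃}, iad_B}∂λ −
  …, B₁,B₂⟩ + (B₁↔B₃) + (B₂↔B₃) + ⟨(δ²/δB²)𝐄(exp iB), −k₂{iad_{B₂}, iad_{B₃}}∂λ, B₁⟩ + (B₁↔B₂) + (B₁↔B₃) +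
  ⟨(δ/δB)𝐄(exp iB), …⟩ = 0."*  *"We are interested in the above identities at B = 0, because such expressions only
  appear in the sum (4.6). This simplifies them in an essential way."* […] (4.14) *"(δ/δB)𝐄(1) = 0.  This equality
  simplifies the identities, and also the sum (4.6), we can drop the term with n = 1. We obtain the following set of
  Ward-Takahashi identities"* (4.15) *"[…] ⟨(δ⁴/δB⁴)𝐄(1), B₁,B₂,B₃, ∂λ⟩ − ⟨(δ³/δB³)𝐄(1), B₁,B₂, i[λ₋,B₃] −
  ½i[B₃,∂λ]⟩ − (B₃↔B₂) − (B₃↔B₁) + ⟨(δ²/δB²)𝐄(1), B₁, k₂{iad_{B₂}, iad_{B₃}}∂λ⟩ + (B₁↔B₂) + (B₁↔B₃) = 0, for an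
  arbitrary gauge function λ, and arbitrary gauge fields B₁, B₂, B₃."*  p. 286 [PDF 38]: *"The first sum can be
  written as ⟨𝐄^{(4)}, δB, B, B, ∂λ_x⟩, where we have indicated the dependence on x explicitly. We apply the third
  identity in (4.15) taking into acount [sic] the special role of the first variable x. It is simplest to
  differentiate this identity with respect to B₁, take B₂ = B₃ = B, λ = λ_x, and then multiply by δB(x) and sum over
  x."*  p. 287 [PDF 39]: *"We get"* (4.24) *"⟨𝐄^{(4)}, δB, B, B, ∂λ_x⟩ = 2⟨𝐄^{(3)}, δB, B, i[λ_x,B] − ½i[B,∂λ_x]⟩ +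
  ⟨𝐄^{(3)}, i[λ_x,δB] − ½i[δB,∂λ_x], B, B⟩ − 2⟨𝐄^{(2)}, δB, k₂(iad_B)²∂λ_x⟩ − 2⟨𝐄^{(2)}, k₂{iad_B, iad_{δB}}∂λ_x,
  B⟩."*  And the bond convention, p. 284: *"The field B_μ(x) = B(x, x + e_μ) = […]"*.  (Inside quotation marks `[…]`
  marks an omission by the author of this file; print's own dots `…` are print's.)
* Dictionary print → Lean (the only modelling choices; all bookkeeping, no analysis) — EXACTLY the parent's
  (`…B12WardSecond415`, itself the grandparent's `…B12Semisimple414`): bonds `b = (x, x + e_ν)` of a finite torus `T`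
  (shifts `e : Λ → T`), the AMBIENT gauge field `W : Λ → T → 𝔄` with values in a complete normed real algebra `𝔄`
  (print: `M_N(ℂ) ⊃ G^c`), the functional `ℰ : (Λ → T → 𝔄) → F` (print's 𝐄), «analytic» weakened to `C⁴` at `W = 1`
  (one order more than the parent), the gauge action (4.7)/(4.8) `W ↦ (exp(tΛ(x)) W_ν(x) exp(−tΛ(x + e_ν)))_{ν,x}`
  (Mathlib's `NormedSpace.exp`), `(∂λ)_ν(y) = λ(y + e_ν) − λ(y)`; the Lie algebra a real normed space `V` represented
  in `𝔄` by `ρ : V →L[ℝ] 𝔄` (print: `𝔤^c ⊂ M_N(ℂ)`; EVERY factor `i` of print — `exp iB`, `exp iλ`, `iad`, `i[·, ·]` —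
  is absorbed into `ρ`: print's `iQ` is our `ρq`, so `i[a, b]` is the `𝔤`-element represented by `[ρa, ρb]` and
  `iad_a iad_b c` the one represented by `[ρa, [ρb, ρc]]`); the chart `B ↦ (exp ρ(B_ν(x)))_{ν,x}` on `𝔤`-valued fields
  `B : Λ → T → V`, written out as a lambda in every statement, `(δᵏ/δBᵏ)𝐄(1)` = the `k`-th Fréchet derivative of the
  chart functional at `B = 0`; gauge functions `λ : T → V` acting through `Λ = ρ ∘ λ`.  The third variation
  `B₃ ↦ i[λ₋, B₃] − ½i[B₃, ∂λ]` of (4.15)₃ is, as in the parent, a `𝔤`-valued field `c₃` prescribed through `ρ`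
  (`hc₃ : ρ(c₃)_ν(x) = [ρλ(x), ρ(B₃)_ν(x)] − ½[ρ(B₃)_ν(x), ρλ(x + e_ν) − ρλ(x)]`, i.e. `λ₋ = λ(x)`, `∂λ` on the bond);
  NEW here, the second-slot test field `k₂{iad_{B₂}, iad_{B₃}}∂λ` of (4.15)₃ (print's `{A, B} = AB + BA` of (4.10),
  `k₂` of (4.8)) is a `𝔤`-valued field `q₂₃` prescribed through `ρ` WITH `k₂ = 1/12`:
  `hq₂₃ : ρ(q₂₃)_ν(x) = (1/12)([ρ(B₂)_ν(x), [ρ(B₃)_ν(x), ρ(∂λ)_ν(x)]] + [ρ(B₃)_ν(x), [ρ(B₂)_ν(x), ρ(∂λ)_ν(x)]])`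
  (commutators written out as `XY − YX`), and in (4.24) `k₂(iad_B)²∂λ_x` is `q'` with `ρq' = (1/12)[ρB, [ρB, ρ∂λ]]`;
  or everything is built from any bracket function `br` with `ρ(br a b) = [ρa, ρb]` (`…_of_bracket`).  The module
  is DEFINITION-FREE.  AMBIENT-TYPING CAVEAT (as in the parent): `ℰ` is asked to be `C⁴` at `1` and gauge invariant
  near `1` as a function of the AMBIENT `𝔄`-valued field; every conclusion concerns only the chart functional
  `B ↦ ℰ(exp ρB)` of `𝔤`-valued fields, so this strengthens the HYPOTHESIS only; the extension is NOT constructed here.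
* The mathematics (print's «differentiations with respect to B» done at `B = 0` through the chart, one order beyond
  the parent; the place where print is silent — how (4.12) at `B = 0` sees the coefficients `½`, `k₂` and the NEXT
  coefficient of `g⁻¹` — made explicit).  For `f(B) = ℰ(exp ρB)`, `Vᵢ = ρBᵢ`, `P = ρ∂λ = N − M`, `M = ρλ₋`, `N = ρλ₊`
  on a bond: (i) the chart calculus to FOURTH order, `d⁴exp(0)(a, b, c, d) = (1/24) Σ_{σ∈S₄} a_σ b_σ c_σ d_σ`
  (Mathlib's exponential SERIES and the symmetrised Taylor formula
  `HasFPowerSeriesOnBall.iteratedFDeriv_eq_sum_of_completeSpace`, the 24 permutations enumerated by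
  `Equiv.Perm.decomposeFin` on top of the parent's `S₃`) and the fourth-order chain rule at a point (15 terms:
  `D⁴ℰ(Y,Y,Y,Y)`, six `D³ℰ(Z,Y,Y)`, four `D²ℰ(W,Y)`, three `D²ℰ(Z,Z)`, one `Dℰ(X)` with `Y = ρu`, `Z = ½{·,·}`,
  `W = ⅙ Σ_{S₃}`, `X = (1/24) Σ_{S₄}`); (ii) (4.7) ⇒ (4.9) `Dℰ(W)[Λ₋W − WΛ₊] = 0` NEAR `W = 1` (gen 20) ⇒ its THIRD
  `W`-derivative at `1` (`…B12Ward414.ward_third_order` for the affine generator `U ↦ L_Λ(1 + U)`):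
  `D⁴ℰ(1)(U₁, U₂, U₃, ∂Λ) = D³ℰ(1)(U₁, U₂, L U₃) + D³ℰ(1)(U₁, U₃, L U₂) + D³ℰ(1)(U₂, U₃, L U₁)`, `L U = Λ₋U − UΛ₊` —
  (4.12) at `B = 0` in the ambient coordinates (§4); (iii) after the chain rules the `D³ℰ(1)`-slots cancel on the
  nose (generator + Jordan term = commutator form, the parent's `gen_add_jordan_eq_commutator_sub`), and what is left
  are POINTWISE identities in the free algebra: the three `D²ℰ(1)(Vᵢ, ·)`-slots `(M J_{jk} − J_{jk} N) +
  S₃(V_j, V_k, P) − ½{V_j, c_k} − ½{V_k, c_j} + q_{jk} = 0` with `q_{jk} = (1/12)([V_j, [V_k, P]] + [V_k, [V_j, P]])`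
  — print's «+⟨(δ²/δB²)𝐄(1), B₁, k₂{iad_{B₂}, iad_{B₃}}∂λ⟩» WITH `k₂ = 1/12`, the `z²`-coefficient of
  `g⁻¹(z) = −z/(e^{−z} − 1)`, PRODUCED by the kernel from `1/2!`, `1/3!` (`residual3_eq_zero`, the parent's residual
  identity plus `twelfth_residual_add_anticommutator_eq_zero`) — and the `Dℰ(1)`-slot `(M S₃ − S₃ N)(V₁, V₂, V₃) +
  S₄(V₁, V₂, V₃, P) − Σᵢ S₃(V_j, V_k, cᵢ) + Σᵢ ½{Vᵢ, q_{jk}} = 0`, which holds IDENTICALLY (`residual4_eq_zero`, from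
  `1/2!`, `1/3!`, `1/4!`): this is the ambient counterpart of the vanishing of the `z³`-coefficient of `g⁻¹` (print's
  (4.8) stops at `k₂z² + …`; `g⁻¹(z) − ½z = (z/2)coth(z/2)` is even, `g⁻¹(z) = 1 + ½z + (1/12)z² − (1/720)z⁴ + …`), i.e.
  of print's last slot «⟨(δ/δB)𝐄(exp iB), …⟩» of (4.12) at `B = 0` — so, UNLIKE (4.15)₁ and (4.15)₂ (parent,
  grandparent: the `Dℰ(1)`-residual there is a nonzero `𝔤`-valued field killed by (4.14)), the third identity at
  `B = 0` needs NEITHER (4.14) NOR «The group G is semisimple»; (iv) regrouping (§5) gives (4.15)₃ with every slot in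
  its natural order; print's literal exchanged slots `⟨𝐄⁽³⁾, B₃, B₂, c_{B₁}⟩`, `⟨𝐄⁽²⁾, B₃, k₂{iad_{B₂}, iad_{B₁}}∂λ⟩`
  and (4.24) then follow from the symmetry of `D³f(0)`, `D²f(0)` (`ContDiffAt.isSymmSndFDerivAt`) (§6).

WHAT IS PROVED (kernel-checked, no `sorry`, standard axioms, NO definitions; bookkeeping theorems, every analytic
input a NAMED HYPOTHESIS):
* §1 [folklore] `sum_perm_fin_four` (enumeration of `S₄`, rows by `Equiv.Perm.decomposeFin` over the parent's `S₃`);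
  `expSeries_apply_four`, `iteratedFDeriv_exp_zero_four` (`d⁴exp(0)(a,b,c,d) = (1/24) Σ_{S₄}`),
  `iteratedFDeriv_four_apply`, `fderiv_fderiv_fderiv_fderiv_chart_zero_apply` (the fourth derivative of the chart at
  `0`, sitewise `(1/24) Σ_{S₄}`).
* §2 [folklore] the fourth-order chain rule at a point for `C⁴` maps between normed spaces,
  `fderiv_fderiv_fderiv_fderiv_comp_apply` (with the evaluation helpers `fderiv_eval_along₂`, `fderiv_eval_along₃`),
  and in the chart at `B = 0`, `fderiv_fderiv_fderiv_fderiv_comp_chart_zero_apply`.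
* §3 [folklore] the pointwise identities `twelfth_residual_add_anticommutator_eq_zero`, `residual3_eq_zero` (the
  `D²ℰ(1)`-slots, `k₂ = 1/12`) and `residual4_eq_zero` (the `Dℰ(1)`-slot vanishes identically: `k₃ = 0`), by
  `noncomm_ring` after clearing denominators.
* §4 `fourth_one_apply_grad_eq` — **(4.7) ⇒ (4.12) at `B = 0` in the ambient `V`-coordinates**:
  `D⁴ℰ(1)(U₁, U₂, U₃, ∂Λ) = D³ℰ(1)(U₁, U₂, Λ₋U₃ − U₃Λ₊) + D³ℰ(1)(U₁, U₃, Λ₋U₂ − U₂Λ₊) + D³ℰ(1)(U₂, U₃, Λ₋U₁ − U₁Λ₊)`.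
* §5 `fourth_chart_apply_grad_eq_zero` — **(4.7) ⇒ (4.15)₃ AT `B = 0` IN THE CHART, for EVERY `𝔤`-valued `λ`, `B₁`,
  `B₂`, `B₃`, with NO (4.14) and NO semisimplicity**: `D⁴f(0)(B₁, B₂, B₃, ∂λ) − D³f(0)(B₁, B₂, c₃) − D³f(0)(B₁, B₃, c₂)
  − D³f(0)(B₂, B₃, c₁) + D²f(0)(B₁, q₂₃) + D²f(0)(B₂, q₁₃) + D²f(0)(B₃, q₁₂) = 0` for any representatives `cᵢ` of
  `i[λ₋, Bᵢ] − ½i[Bᵢ, ∂λ]` and `q_{jk}` of `k₂{iad_{B_j}, iad_{B_k}}∂λ`, `k₂ = 1/12`.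
* §6 `fderiv_fderiv_fderiv_apply_swap_left`, `…_swap_right` [folklore] (symmetry of `D³f(x)` in its slots for a `C³`
  map), `contDiffAt_three_comp_chart`; `fourth_chart_apply_grad_eq_zero_literal` — (4.15)₃ with the two exchanged
  terms in PRINT'S LITERAL slot orders `⟨𝐄⁽³⁾, B₃, B₂, c_{B₁}⟩`, `⟨𝐄⁽²⁾, B₃, k₂{iad_{B₂}, iad_{B₁}}∂λ⟩`;
  `fourth_chart_apply_grad_eq_zero_of_bracket` (everything built from a bracket function `br`);
  `fourth_chart_apply_diag_eq` — **the pointwise identity behind (4.24), p. 287, with print's coefficients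
  `2, 1, −2, −2` and slot orders**: for one gauge function (print's `λ_x`, `x` fixed) and fields `δB`, `B`,
  `D⁴f(0)(δB, B, B, ∂λ) = 2 D³f(0)(δB, B, c_B) + D³f(0)(c_{δB}, B, B) − 2 D²f(0)(δB, q') − 2 D²f(0)(q'', B)` with
  `ρq' = (1/12)[ρB, [ρB, ρ∂λ]]` (print's `k₂(iad_B)²∂λ_x`) and `ρq'' = (1/12)([ρB, [ρδB, ρ∂λ]] + [ρδB, [ρB, ρ∂λ]])`
  (print's `k₂{iad_B, iad_{δB}}∂λ_x`) — (4.15)₃ with `B₁ = δB`, `B₂ = B₃ = B` (print: «differentiate this identity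
  with respect to B₁» — it is linear in `B₁`), `{iad_B, iad_B} = 2(iad_B)²`, and the slot symmetries.  This settles
  the coefficient pattern of (4.24) that the lineage transcript had left as a deferred conditional check.

WHAT IS NOT PROVED HERE (and not claimed): (4.10)–(4.12) AWAY from `B = 0` (the `B`-dependent generator
`i[λ₋, B] − g⁻¹(iad_B)∂λ`, i.e. `d log` away from `0`, is not constructed in the lineage — the identities here come
from the ambient flow of (4.7), and print's coefficients `½`, `k₂ = 1/12`, `k₃ = 0` appear as OUTPUT); the SUMMED
form of (4.24) («multiply by δB(x) and sum over x», with the `x`-dependent pure gauge `λ_x` of (4.23)) and everything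
print draws from it on pp. 287–288 ((4.25)–(4.31): the irrelevance of the individual terms, which is analysis on
`𝐄^{(n)}` with the bounds (4.22)); the existence, analyticity and gauge invariance of print's effective actions
`𝐄^{(j)}` (B12 §§2–3) and their kernels `𝐄^{(n)}(x₁, …, x_n)`; the ambient extension of the caveat above; nothing
about B13 or the continuum limit.  The abstract `…B12Ward414.ward_third_order_of_fderiv_eq_zero` (gen 5; hypothesis: a
`C³` generator FIELD on the chart annihilated by `Df`, and (4.14)) is NOT used, for the reason recorded in the parent.

HONEST FRAMING: value = print's third Ward–Takahashi identity (4.15)₃ — the one that converts the marginal quartic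
term `⟨𝐄⁽⁴⁾, δB, B, B, B⟩` of (4.21) through (4.23)–(4.24) into terms print then bounds as irrelevant (pp. 286–288:
«KEY MECHANISM of §4» in the lineage transcript's words, no quartic counterterm) — is now a kernel-checked
consequence, at `B = 0` in print's own setting of `𝔤`-valued `B`, `λ`, of (4.7) ALONE, with print's implicit
bookkeeping (fourth-order chart calculus, the coefficients of (4.8)) done over Mathlib's exponential series,
CONFIRMING `k₂ = 1/12` in the new `(δ²/δB²)`-slot and showing that the `(δ/δB)`-slot of (4.12) is absent at `B = 0`
for the structural reason `k₃ = 0`; plus the exact coefficients of (4.24).  NOT summit progress: bookkeeping of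
printed displays; every analytic statement remains a hypothesis.
-/

namespace Literature.MathematicalPhysics.QuantumFieldTheory.Balaban1983to89.B12WardThird415

open Literature.MathematicalPhysics.QuantumFieldTheory.Balaban1983to89.B12Ward414 (ward_third_order
  fderiv_eval_along fderiv_eval_const)
open Literature.MathematicalPhysics.QuantumFieldTheory.Balaban1983to89.B12GaugeInv47 (exists_generatorCLM
  fderiv_apply_gaugeGenerator_eq_zero)
open Literature.MathematicalPhysics.QuantumFieldTheory.Balaban1983to89.B12Semisimple414 (contDiff_exp chart_zero
  contDiff_chart fderiv_chart_zero_apply fderiv_fderiv_chart_zero_apply fderiv_fderiv_comp_chart_zero_apply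
  hessian_one_apply_grad_eq)
open Literature.MathematicalPhysics.QuantumFieldTheory.Balaban1983to89.B12WardSecond415 (sum_perm_fin_three
  iteratedFDeriv_three_apply fderiv_fderiv_fderiv_chart_zero_apply fderiv_fderiv_fderiv_comp_apply
  fderiv_fderiv_fderiv_comp_chart_zero_apply third_one_apply_grad_eq gen_add_jordan_eq_commutator_sub)
open Literature.MathematicalPhysics.QuantumFieldTheory.Balaban1983to89.B12Schur433 (hessian_chart_symm)
open NormedSpace (exp expSeries exp_hasFPowerSeriesOnBall)
open Filter
open _root_.Topology

/-! ## §1. [folklore] `S₄`, the quartic term of the exponential series, the fourth derivative of the chart at `0` -/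

section SymmetricGroupFour

open Equiv

/-- Row expansion of a sum over the permutations of `Fin (n+1)` (`Finset.univ_perm_fin_succ`). [folklore] -/
private theorem sum_perm_fin_succ_eq_sum_decomposeFin {α : Type*} [AddCommMonoid α] {n : ℕ}
    (f : Perm (Fin (n + 1)) → α) :
    ∑ σ, f σ = ∑ p : Fin (n + 1), ∑ e : Perm (Fin n), f (Perm.decomposeFin.symm (p, e)) := by
  rw [Finset.univ_perm_fin_succ, Finset.sum_map, ← Finset.univ_product_univ, Finset.sum_product]
  rfl

/-- Row-expansion bookkeeping in `S₄`: `decomposeFin⁻¹(p,e)(k+1) = (0 p)(e(k)+1)`. [folklore] -/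
private theorem dfs4_succ (e : Perm (Fin 3)) (p : Fin 4) (k : Fin 3) :
    Perm.decomposeFin.symm (p, e) k.succ = swap 0 p (e k).succ :=
  Perm.decomposeFin_symm_apply_succ e p k

/-- The inner `S₃`-sum of the row expansion of `S₄`. [folklore] -/
private theorem sum_perm_fin_four_row {α : Type*} [AddCommMonoid α] (g : Fin 4 → Fin 4 → Fin 4 → Fin 4 → α)
    (p : Fin 4) :
    ∑ e : Perm (Fin 3), g (Perm.decomposeFin.symm (p, e) 0) (Perm.decomposeFin.symm (p, e) 1)
        (Perm.decomposeFin.symm (p, e) 2) (Perm.decomposeFin.symm (p, e) 3) =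
      g p (swap 0 p 1) (swap 0 p 2) (swap 0 p 3) + g p (swap 0 p 1) (swap 0 p 3) (swap 0 p 2) +
      g p (swap 0 p 2) (swap 0 p 1) (swap 0 p 3) + g p (swap 0 p 2) (swap 0 p 3) (swap 0 p 1) +
      g p (swap 0 p 3) (swap 0 p 1) (swap 0 p 2) + g p (swap 0 p 3) (swap 0 p 2) (swap 0 p 1) := by
  have h1 : ∀ e : Perm (Fin 3), Perm.decomposeFin.symm (p, e) 1 = swap 0 p (e 0).succ := fun e => dfs4_succ e p 0
  have h2 : ∀ e : Perm (Fin 3), Perm.decomposeFin.symm (p, e) 2 = swap 0 p (e 1).succ := fun e => dfs4_succ e p 1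
  have h3 : ∀ e : Perm (Fin 3), Perm.decomposeFin.symm (p, e) 3 = swap 0 p (e 2).succ := fun e => dfs4_succ e p 2
  simp only [Perm.decomposeFin_symm_apply_zero, h1, h2, h3]
  exact sum_perm_fin_three (fun i j k => g p (swap 0 p i.succ) (swap 0 p j.succ) (swap 0 p k.succ))

/-- **Enumeration of `S₄`**: `Σ_{σ ∈ S₄} g(σ0, σ1, σ2, σ3)` written out as its twenty-four terms. [folklore] -/
theorem sum_perm_fin_four {α : Type*} [AddCommMonoid α] (g : Fin 4 → Fin 4 → Fin 4 → Fin 4 → α) :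
    ∑ σ : Perm (Fin 4), g (σ 0) (σ 1) (σ 2) (σ 3) =
      g 0 1 2 3 + g 0 1 3 2 + g 0 2 1 3 + g 0 2 3 1 + g 0 3 1 2 + g 0 3 2 1 + g 1 0 2 3 + g 1 0 3 2 +
      g 1 2 0 3 + g 1 2 3 0 + g 1 3 0 2 + g 1 3 2 0 + g 2 0 1 3 + g 2 0 3 1 + g 2 1 0 3 + g 2 1 3 0 +
      g 2 3 0 1 + g 2 3 1 0 + g 3 0 1 2 + g 3 0 2 1 + g 3 1 0 2 + g 3 1 2 0 + g 3 2 0 1 + g 3 2 1 0 := by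
  rw [sum_perm_fin_succ_eq_sum_decomposeFin]
  simp only [sum_perm_fin_four_row]
  simp [Fin.sum_univ_succ, Equiv.swap_apply_def]
  abel

end SymmetricGroupFour

section ExpFourth

variable {𝔄 : Type*} [NormedRing 𝔄] [NormedAlgebra ℝ 𝔄] [CompleteSpace 𝔄]

omit [CompleteSpace 𝔄] in
/-- The quartic term of Mathlib's exponential series: `(expSeries ℝ 𝔄 4)(a, b, c, d) = (1/24)·abcd`. [folklore] -/
theorem expSeries_apply_four (m : Fin 4 → 𝔄) : expSeries ℝ 𝔄 4 m = (24 : ℝ)⁻¹ • (m 0 * m 1 * m 2 * m 3) := by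
  have h4 : Nat.factorial 4 = 24 := rfl
  simp [expSeries, h4, List.ofFn_succ, mul_assoc]

/-- **`d⁴exp(0)(a, b, c, d) = (1/24) Σ_{σ∈S₄} a_σ b_σ c_σ d_σ`** in a complete normed real algebra. [folklore] -/
theorem iteratedFDeriv_exp_zero_four (m : Fin 4 → 𝔄) :
    iteratedFDeriv ℝ 4 (exp : 𝔄 → 𝔄) 0 m = (24 : ℝ)⁻¹ • (m 0 * m 1 * m 2 * m 3 + m 0 * m 1 * m 3 * m 2 +
      m 0 * m 2 * m 1 * m 3 + m 0 * m 2 * m 3 * m 1 + m 0 * m 3 * m 1 * m 2 + m 0 * m 3 * m 2 * m 1 +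
      m 1 * m 0 * m 2 * m 3 + m 1 * m 0 * m 3 * m 2 + m 1 * m 2 * m 0 * m 3 + m 1 * m 2 * m 3 * m 0 +
      m 1 * m 3 * m 0 * m 2 + m 1 * m 3 * m 2 * m 0 + m 2 * m 0 * m 1 * m 3 + m 2 * m 0 * m 3 * m 1 +
      m 2 * m 1 * m 0 * m 3 + m 2 * m 1 * m 3 * m 0 + m 2 * m 3 * m 0 * m 1 + m 2 * m 3 * m 1 * m 0 +
      m 3 * m 0 * m 1 * m 2 + m 3 * m 0 * m 2 * m 1 + m 3 * m 1 * m 0 * m 2 + m 3 * m 1 * m 2 * m 0 +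
      m 3 * m 2 * m 0 * m 1 + m 3 * m 2 * m 1 * m 0) := by
  rw [(exp_hasFPowerSeriesOnBall (𝕂 := ℝ) (𝔸 := 𝔄)).iteratedFDeriv_eq_sum_of_completeSpace]
  simp only [expSeries_apply_four]
  rw [← Finset.smul_sum, sum_perm_fin_four (fun i j k l => m i * m j * m k * m l)]

/-- `D⁴f(z)(m₀, m₁, m₂, m₃) = fderiv (fderiv (fderiv (fderiv f))) z m₀ m₁ m₂ m₃`. [folklore] -/
theorem iteratedFDeriv_four_apply {E F : Type*} [NormedAddCommGroup E] [NormedSpace ℝ E] [NormedAddCommGroup F]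
    [NormedSpace ℝ F] (f : E → F) (z : E) (m : Fin 4 → E) :
    iteratedFDeriv ℝ 4 f z m = fderiv ℝ (fderiv ℝ (fderiv ℝ (fderiv ℝ f))) z (m 0) (m 1) (m 2) (m 3) := by
  rw [iteratedFDeriv_succ_apply_right, iteratedFDeriv_three_apply]
  rfl

variable {Λ T : Type*} [Fintype Λ] [Fintype T] {V : Type*} [NormedAddCommGroup V] [NormedSpace ℝ V]
  {F : Type*} [NormedAddCommGroup F] [NormedSpace ℝ F]

-- The triply nested operator space over the iterated `Pi` type needs more levels of pending instance synthesis than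
-- Lean's default (as in Mathlib's `OperatorNorm` files).
set_option maxSynthPendingDepth 3 in
/-- **`d⁴(exp iρB)|_{B=0}(u, v, w, z) = ((1/24) Σ_{S₄} ρu_ν(x)·ρv_ν(x)·ρw_ν(x)·ρz_ν(x))_{ν,x}`**. [folklore] -/
theorem fderiv_fderiv_fderiv_fderiv_chart_zero_apply (ρ : V →L[ℝ] 𝔄) (u v w z : Λ → T → V) :
    fderiv ℝ (fderiv ℝ (fderiv ℝ (fderiv ℝ (fun B : Λ → T → V => fun ν x => exp (ρ (B ν x)))))) 0 u v w z =
      fun ν x => (24 : ℝ)⁻¹ • (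
        ρ (u ν x) * ρ (v ν x) * ρ (w ν x) * ρ (z ν x) + ρ (u ν x) * ρ (v ν x) * ρ (z ν x) * ρ (w ν x) +
        ρ (u ν x) * ρ (w ν x) * ρ (v ν x) * ρ (z ν x) + ρ (u ν x) * ρ (w ν x) * ρ (z ν x) * ρ (v ν x) +
        ρ (u ν x) * ρ (z ν x) * ρ (v ν x) * ρ (w ν x) + ρ (u ν x) * ρ (z ν x) * ρ (w ν x) * ρ (v ν x) +
        ρ (v ν x) * ρ (u ν x) * ρ (w ν x) * ρ (z ν x) + ρ (v ν x) * ρ (u ν x) * ρ (z ν x) * ρ (w ν x) +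
        ρ (v ν x) * ρ (w ν x) * ρ (u ν x) * ρ (z ν x) + ρ (v ν x) * ρ (w ν x) * ρ (z ν x) * ρ (u ν x) +
        ρ (v ν x) * ρ (z ν x) * ρ (u ν x) * ρ (w ν x) + ρ (v ν x) * ρ (z ν x) * ρ (w ν x) * ρ (u ν x) +
        ρ (w ν x) * ρ (u ν x) * ρ (v ν x) * ρ (z ν x) + ρ (w ν x) * ρ (u ν x) * ρ (z ν x) * ρ (v ν x) +
        ρ (w ν x) * ρ (v ν x) * ρ (u ν x) * ρ (z ν x) + ρ (w ν x) * ρ (v ν x) * ρ (z ν x) * ρ (u ν x) +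
        ρ (w ν x) * ρ (z ν x) * ρ (u ν x) * ρ (v ν x) + ρ (w ν x) * ρ (z ν x) * ρ (v ν x) * ρ (u ν x) +
        ρ (z ν x) * ρ (u ν x) * ρ (v ν x) * ρ (w ν x) + ρ (z ν x) * ρ (u ν x) * ρ (w ν x) * ρ (v ν x) +
        ρ (z ν x) * ρ (v ν x) * ρ (u ν x) * ρ (w ν x) + ρ (z ν x) * ρ (v ν x) * ρ (w ν x) * ρ (u ν x) +
        ρ (z ν x) * ρ (w ν x) * ρ (u ν x) * ρ (v ν x) + ρ (z ν x) * ρ (w ν x) * ρ (v ν x) * ρ (u ν x)) := by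
  funext ν x
  set Φ : (Λ → T → V) → Λ → T → 𝔄 := fun B ν x => exp (ρ (B ν x)) with hΦ
  have hC : ContDiff ℝ 4 Φ := contDiff_chart ρ
  set ev : (Λ → T → 𝔄) →L[ℝ] 𝔄 := (ContinuousLinearMap.proj (R := ℝ) (φ := fun _ : T => 𝔄) x).comp
    (ContinuousLinearMap.proj (R := ℝ) (φ := fun _ : Λ => T → 𝔄) ν) with hev
  set L : (Λ → T → V) →L[ℝ] 𝔄 := ρ.comp ((ContinuousLinearMap.proj (R := ℝ) (φ := fun _ : T => V) x).comp
    (ContinuousLinearMap.proj (R := ℝ) (φ := fun _ : Λ => T → V) ν)) with hL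
  have h1 : (ev : (Λ → T → 𝔄) → 𝔄) ∘ Φ = (exp : 𝔄 → 𝔄) ∘ (L : (Λ → T → V) → 𝔄) := by
    funext B
    simp [hΦ, hev, hL]
  calc fderiv ℝ (fderiv ℝ (fderiv ℝ (fderiv ℝ Φ))) 0 u v w z ν x
      = ev (iteratedFDeriv ℝ 4 Φ 0 ![u, v, w, z]) := by
          rw [iteratedFDeriv_four_apply]
          simp [hev]
    _ = iteratedFDeriv ℝ 4 ((ev : (Λ → T → 𝔄) → 𝔄) ∘ Φ) 0 ![u, v, w, z] := by
          rw [ev.iteratedFDeriv_comp_left hC.contDiffAt (i := 4) le_rfl]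
          rfl
    _ = iteratedFDeriv ℝ 4 ((exp : 𝔄 → 𝔄) ∘ (L : (Λ → T → V) → 𝔄)) 0 ![u, v, w, z] := by rw [h1]
    _ = iteratedFDeriv ℝ 4 (exp : 𝔄 → 𝔄) (L 0) (fun i => L (![u, v, w, z] i)) := by
          rw [L.iteratedFDeriv_comp_right (contDiff_exp (n := 4)) 0 (i := 4) le_rfl]
          rfl
    _ = iteratedFDeriv ℝ 4 (exp : 𝔄 → 𝔄) 0 ![ρ (u ν x), ρ (v ν x), ρ (w ν x), ρ (z ν x)] := by
          rw [map_zero]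
          congr 1
          funext i
          fin_cases i <;> simp [hL]
    _ = _ := by
          rw [iteratedFDeriv_exp_zero_four]
          simp

end ExpFourth

/-! ## §2. [folklore] The fourth-order chain rule at a point, and in the chart at `B = 0` -/

section ChainRule

variable {𝕜 : Type*} [NontriviallyNormedField 𝕜] {E G H : Type*} [NormedAddCommGroup E] [NormedSpace 𝕜 E]
  [NormedAddCommGroup G] [NormedSpace 𝕜 G] [NormedAddCommGroup H] [NormedSpace 𝕜 H]

/-- Calculus helper: the product rule for `B ↦ A(B)(Y₁(B), Y₂(B))`, `A` bilinear-map valued. [folklore] -/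
theorem fderiv_eval_along₂ {A : E → G →L[𝕜] G →L[𝕜] H} {Y₁ Y₂ : E → G} {x : E} (hA : DifferentiableAt 𝕜 A x)
    (h₁ : DifferentiableAt 𝕜 Y₁ x) (h₂ : DifferentiableAt 𝕜 Y₂ x) (u : E) :
    fderiv 𝕜 (fun B => A B (Y₁ B) (Y₂ B)) x u =
      A x (Y₁ x) (fderiv 𝕜 Y₂ x u) + A x (fderiv 𝕜 Y₁ x u) (Y₂ x) + fderiv 𝕜 A x u (Y₁ x) (Y₂ x) := by
  rw [fderiv_eval_along (hA.clm_apply h₁) h₂ u, fderiv_eval_along hA h₁ u, _root_.add_apply, add_assoc]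

/-- Calculus helper: the product rule for `B ↦ A(B)(Y₁(B), Y₂(B), Y₃(B))`, `A` trilinear-map valued. [folklore] -/
theorem fderiv_eval_along₃ {A : E → G →L[𝕜] G →L[𝕜] G →L[𝕜] H} {Y₁ Y₂ Y₃ : E → G} {x : E}
    (hA : DifferentiableAt 𝕜 A x) (h₁ : DifferentiableAt 𝕜 Y₁ x) (h₂ : DifferentiableAt 𝕜 Y₂ x)
    (h₃ : DifferentiableAt 𝕜 Y₃ x) (u : E) :
    fderiv 𝕜 (fun B => A B (Y₁ B) (Y₂ B) (Y₃ B)) x u =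
      A x (Y₁ x) (Y₂ x) (fderiv 𝕜 Y₃ x u) + A x (Y₁ x) (fderiv 𝕜 Y₂ x u) (Y₃ x) +
        A x (fderiv 𝕜 Y₁ x u) (Y₂ x) (Y₃ x) + fderiv 𝕜 A x u (Y₁ x) (Y₂ x) (Y₃ x) := by
  rw [fderiv_eval_along ((hA.clm_apply h₁).clm_apply h₂) h₃ u, fderiv_eval_along₂ hA h₁ h₂ u, _root_.add_apply,
    _root_.add_apply]
  simp only [add_assoc]

set_option maxSynthPendingDepth 3 in
set_option maxHeartbeats 400000 in
/-- **Fourth-order chain rule at a point**: for `Φ` `C⁴` at `x` and `ℰ` `C⁴` at `Φ x`, with `Yᵢ = DΦ(x)uᵢ`,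
`Zᵢⱼ = D²Φ(x)(uᵢ, uⱼ)`, `Wᵢⱼₖ = D³Φ(x)(uᵢ, uⱼ, uₖ)`:
`D⁴(ℰ∘Φ)(x)(u₁, u₂, u₃, u₄) = D⁴ℰ(Y₁,Y₂,Y₃,Y₄) + D³ℰ(Z₁₂,Y₃,Y₄) + D³ℰ(Y₂,Z₁₃,Y₄) + D³ℰ(Y₂,Y₃,Z₁₄) + D³ℰ(Y₁,Z₂₃,Y₄)
+ D³ℰ(Y₁,Y₂,Z₃₄) + D³ℰ(Y₁,Y₃,Z₂₄) + D²ℰ(W₁₂₃,Y₄) + D²ℰ(Z₂₃,Z₁₄) + D²ℰ(Z₁₂,Z₃₄) + D²ℰ(Y₂,W₁₃₄) + D²ℰ(Z₁₃,Z₂₄)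
+ D²ℰ(Y₃,W₁₂₄) + D²ℰ(Y₁,W₂₃₄) + Dℰ[D⁴Φ(x)(u₁,u₂,u₃,u₄)]` (all derivatives of `ℰ` at `Φ x`; the fifteen terms are
indexed by the set partitions of `{1,2,3,4}`).  Proof: near `x` the third-order formula
(`…B12WardSecond415.fderiv_fderiv_fderiv_comp_apply`) holds; differentiate it once more at `x` with the product rules
above and the chain rules of orders one to three for `D^kℰ ∘ Φ`. [folklore] -/
theorem fderiv_fderiv_fderiv_fderiv_comp_apply {Φ : E → G} {ℰ : G → H} {x : E} (hΦ : ContDiffAt 𝕜 4 Φ x)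
    (hℰ : ContDiffAt 𝕜 4 ℰ (Φ x)) (u₁ u₂ u₃ u₄ : E) :
    fderiv 𝕜 (fderiv 𝕜 (fderiv 𝕜 (fderiv 𝕜 (fun B => ℰ (Φ B))))) x u₁ u₂ u₃ u₄ =
      fderiv 𝕜 (fderiv 𝕜 (fderiv 𝕜 (fderiv 𝕜 ℰ))) (Φ x) (fderiv 𝕜 Φ x u₁) (fderiv 𝕜 Φ x u₂) (fderiv 𝕜 Φ x u₃)
          (fderiv 𝕜 Φ x u₄)
      + fderiv 𝕜 (fderiv 𝕜 (fderiv 𝕜 ℰ)) (Φ x) (fderiv 𝕜 (fderiv 𝕜 Φ) x u₁ u₂) (fderiv 𝕜 Φ x u₃) (fderiv 𝕜 Φ x u₄)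
      + fderiv 𝕜 (fderiv 𝕜 (fderiv 𝕜 ℰ)) (Φ x) (fderiv 𝕜 Φ x u₂) (fderiv 𝕜 (fderiv 𝕜 Φ) x u₁ u₃) (fderiv 𝕜 Φ x u₄)
      + fderiv 𝕜 (fderiv 𝕜 (fderiv 𝕜 ℰ)) (Φ x) (fderiv 𝕜 Φ x u₂) (fderiv 𝕜 Φ x u₃) (fderiv 𝕜 (fderiv 𝕜 Φ) x u₁ u₄)
      + fderiv 𝕜 (fderiv 𝕜 (fderiv 𝕜 ℰ)) (Φ x) (fderiv 𝕜 Φ x u₁) (fderiv 𝕜 (fderiv 𝕜 Φ) x u₂ u₃) (fderiv 𝕜 Φ x u₄)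
      + fderiv 𝕜 (fderiv 𝕜 (fderiv 𝕜 ℰ)) (Φ x) (fderiv 𝕜 Φ x u₁) (fderiv 𝕜 Φ x u₂) (fderiv 𝕜 (fderiv 𝕜 Φ) x u₃ u₄)
      + fderiv 𝕜 (fderiv 𝕜 (fderiv 𝕜 ℰ)) (Φ x) (fderiv 𝕜 Φ x u₁) (fderiv 𝕜 Φ x u₃) (fderiv 𝕜 (fderiv 𝕜 Φ) x u₂ u₄)
      + fderiv 𝕜 (fderiv 𝕜 ℰ) (Φ x) (fderiv 𝕜 (fderiv 𝕜 (fderiv 𝕜 Φ)) x u₁ u₂ u₃) (fderiv 𝕜 Φ x u₄)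
      + fderiv 𝕜 (fderiv 𝕜 ℰ) (Φ x) (fderiv 𝕜 (fderiv 𝕜 Φ) x u₂ u₃) (fderiv 𝕜 (fderiv 𝕜 Φ) x u₁ u₄)
      + fderiv 𝕜 (fderiv 𝕜 ℰ) (Φ x) (fderiv 𝕜 (fderiv 𝕜 Φ) x u₁ u₂) (fderiv 𝕜 (fderiv 𝕜 Φ) x u₃ u₄)
      + fderiv 𝕜 (fderiv 𝕜 ℰ) (Φ x) (fderiv 𝕜 Φ x u₂) (fderiv 𝕜 (fderiv 𝕜 (fderiv 𝕜 Φ)) x u₁ u₃ u₄)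
      + fderiv 𝕜 (fderiv 𝕜 ℰ) (Φ x) (fderiv 𝕜 (fderiv 𝕜 Φ) x u₁ u₃) (fderiv 𝕜 (fderiv 𝕜 Φ) x u₂ u₄)
      + fderiv 𝕜 (fderiv 𝕜 ℰ) (Φ x) (fderiv 𝕜 Φ x u₃) (fderiv 𝕜 (fderiv 𝕜 (fderiv 𝕜 Φ)) x u₁ u₂ u₄)
      + fderiv 𝕜 (fderiv 𝕜 ℰ) (Φ x) (fderiv 𝕜 Φ x u₁) (fderiv 𝕜 (fderiv 𝕜 (fderiv 𝕜 Φ)) x u₂ u₃ u₄)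
      + fderiv 𝕜 ℰ (Φ x) (fderiv 𝕜 (fderiv 𝕜 (fderiv 𝕜 (fderiv 𝕜 Φ))) x u₁ u₂ u₃ u₄) := by
  -- `C⁴` data near `x`
  have hΦnear : ∀ᶠ B in 𝓝 x, ContDiffAt 𝕜 4 Φ B := hΦ.eventually (by simp)
  have hℰnear : ∀ᶠ B in 𝓝 x, ContDiffAt 𝕜 4 ℰ (Φ B) :=
    hΦ.continuousAt.tendsto.eventually (hℰ.eventually (by simp))
  have hf : ContDiffAt 𝕜 4 (fun B => ℰ (Φ B)) x := hℰ.comp x hΦ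
  -- Step 1: near `x`, the third-order chain rule
  have h3 : (fun B => fderiv 𝕜 (fderiv 𝕜 (fderiv 𝕜 (fun B => ℰ (Φ B)))) B u₂ u₃ u₄) =ᶠ[𝓝 x] fun B =>
      fderiv 𝕜 (fderiv 𝕜 (fderiv 𝕜 ℰ)) (Φ B) (fderiv 𝕜 Φ B u₂) (fderiv 𝕜 Φ B u₃) (fderiv 𝕜 Φ B u₄)
      + fderiv 𝕜 (fderiv 𝕜 ℰ) (Φ B) (fderiv 𝕜 (fderiv 𝕜 Φ) B u₂ u₃) (fderiv 𝕜 Φ B u₄)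
      + fderiv 𝕜 (fderiv 𝕜 ℰ) (Φ B) (fderiv 𝕜 Φ B u₂) (fderiv 𝕜 (fderiv 𝕜 Φ) B u₃ u₄)
      + fderiv 𝕜 (fderiv 𝕜 ℰ) (Φ B) (fderiv 𝕜 Φ B u₃) (fderiv 𝕜 (fderiv 𝕜 Φ) B u₂ u₄)
      + fderiv 𝕜 ℰ (Φ B) (fderiv 𝕜 (fderiv 𝕜 (fderiv 𝕜 Φ)) B u₂ u₃ u₄) := by
    filter_upwards [hΦnear, hℰnear] with B hB hB'
    exact fderiv_fderiv_fderiv_comp_apply (hB.of_le (by norm_num)) (hB'.of_le (by norm_num)) u₂ u₃ u₄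
  -- Step 2: `D⁴(ℰ∘Φ)(x)(u₁, u₂, u₃, u₄) = fderiv (B ↦ D³(ℰ∘Φ)(B)(u₂, u₃, u₄)) x u₁`
  have hd3 : DifferentiableAt 𝕜 (fderiv 𝕜 (fderiv 𝕜 (fderiv 𝕜 (fun B => ℰ (Φ B))))) x :=
    (((hf.fderiv_right (m := 3) (by norm_num)).fderiv_right (m := 2) (by norm_num)).fderiv_right (m := 1)
      (by norm_num)).differentiableAt (by simp)
  -- (the implicit `c`, `u` / `A` are given explicitly: at this depth of iterated `→L` spaces the elaborator does not
  -- unify the operator-norm instance chain with the directly synthesized one on its own — as in `…B12Ward414`)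
  have hd3' : DifferentiableAt 𝕜 (fun B => fderiv 𝕜 (fderiv 𝕜 (fderiv 𝕜 (fun B => ℰ (Φ B)))) B u₂) x :=
    DifferentiableAt.clm_apply (c := fderiv 𝕜 (fderiv 𝕜 (fderiv 𝕜 (fun B => ℰ (Φ B))))) (u := fun _ : E => u₂)
      hd3 (differentiableAt_const u₂)
  have hd3'' : DifferentiableAt 𝕜 (fun B => fderiv 𝕜 (fderiv 𝕜 (fderiv 𝕜 (fun B => ℰ (Φ B)))) B u₂ u₃) x :=
    hd3'.clm_apply (differentiableAt_const u₃)
  rw [← fderiv_eval_const (A := fderiv 𝕜 (fderiv 𝕜 (fderiv 𝕜 (fun B => ℰ (Φ B))))) hd3 u₂ u₁,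
    ← fderiv_eval_const hd3' u₃ u₁, ← fderiv_eval_const hd3'' u₄ u₁, h3.fderiv_eq]
  -- differentiability at `x` of all the factors
  have hΦ1 : DifferentiableAt 𝕜 (fderiv 𝕜 Φ) x :=
    (hΦ.fderiv_right (m := 3) (by norm_num)).differentiableAt (by simp)
  have hΦ2 : DifferentiableAt 𝕜 (fderiv 𝕜 (fderiv 𝕜 Φ)) x :=
    ((hΦ.fderiv_right (m := 3) (by norm_num)).fderiv_right (m := 2) (by norm_num)).differentiableAt (by simp)
  have hΦ3 : DifferentiableAt 𝕜 (fderiv 𝕜 (fderiv 𝕜 (fderiv 𝕜 Φ))) x :=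
    (((hΦ.fderiv_right (m := 3) (by norm_num)).fderiv_right (m := 2) (by norm_num)).fderiv_right (m := 1)
      (by norm_num)).differentiableAt (by simp)
  have hΦd : DifferentiableAt 𝕜 Φ x := hΦ.differentiableAt (by simp)
  have hY : ∀ v, DifferentiableAt 𝕜 (fun B => fderiv 𝕜 Φ B v) x := fun v => hΦ1.clm_apply (differentiableAt_const v)
  have hZ' : ∀ v, DifferentiableAt 𝕜 (fun B => fderiv 𝕜 (fderiv 𝕜 Φ) B v) x := fun v =>
    hΦ2.clm_apply (differentiableAt_const v)
  have hZ : ∀ v w, DifferentiableAt 𝕜 (fun B => fderiv 𝕜 (fderiv 𝕜 Φ) B v w) x := fun v w =>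
    (hZ' v).clm_apply (differentiableAt_const w)
  have hW' : ∀ v, DifferentiableAt 𝕜 (fun B => fderiv 𝕜 (fderiv 𝕜 (fderiv 𝕜 Φ)) B v) x := fun v =>
    DifferentiableAt.clm_apply (c := fderiv 𝕜 (fderiv 𝕜 (fderiv 𝕜 Φ))) (u := fun _ : E => v) hΦ3
      (differentiableAt_const v)
  have hW'' : ∀ v w, DifferentiableAt 𝕜 (fun B => fderiv 𝕜 (fderiv 𝕜 (fderiv 𝕜 Φ)) B v w) x := fun v w =>
    (hW' v).clm_apply (differentiableAt_const w)
  have hW : ∀ v w z, DifferentiableAt 𝕜 (fun B => fderiv 𝕜 (fderiv 𝕜 (fderiv 𝕜 Φ)) B v w z) x := fun v w z =>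
    (hW'' v w).clm_apply (differentiableAt_const z)
  have hℰ1 : DifferentiableAt 𝕜 (fderiv 𝕜 ℰ) (Φ x) :=
    (hℰ.fderiv_right (m := 3) (by norm_num)).differentiableAt (by simp)
  have hℰ2 : DifferentiableAt 𝕜 (fderiv 𝕜 (fderiv 𝕜 ℰ)) (Φ x) :=
    ((hℰ.fderiv_right (m := 3) (by norm_num)).fderiv_right (m := 2) (by norm_num)).differentiableAt (by simp)
  have hℰ3 : DifferentiableAt 𝕜 (fderiv 𝕜 (fderiv 𝕜 (fderiv 𝕜 ℰ))) (Φ x) :=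
    (((hℰ.fderiv_right (m := 3) (by norm_num)).fderiv_right (m := 2) (by norm_num)).fderiv_right (m := 1)
      (by norm_num)).differentiableAt (by simp)
  have hA1 : DifferentiableAt 𝕜 (fun B => fderiv 𝕜 ℰ (Φ B)) x := hℰ1.comp x hΦd
  have hA2 : DifferentiableAt 𝕜 (fun B => fderiv 𝕜 (fderiv 𝕜 ℰ) (Φ B)) x := hℰ2.comp x hΦd
  have hA3 : DifferentiableAt 𝕜 (fun B => fderiv 𝕜 (fderiv 𝕜 (fderiv 𝕜 ℰ)) (Φ B)) x := hℰ3.comp x hΦd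
  -- the chain rules of order one for `D^kℰ ∘ Φ`, `k = 1, 2, 3`, at `x`
  have hDA1 : ∀ z, fderiv 𝕜 (fun B => fderiv 𝕜 ℰ (Φ B)) x z = fderiv 𝕜 (fderiv 𝕜 ℰ) (Φ x) (fderiv 𝕜 Φ x z) := by
    intro z
    rw [fderiv_fun_comp (x := x) hℰ1 hΦd]
    rfl
  have hDA2 : ∀ z, fderiv 𝕜 (fun B => fderiv 𝕜 (fderiv 𝕜 ℰ) (Φ B)) x z =
      fderiv 𝕜 (fderiv 𝕜 (fderiv 𝕜 ℰ)) (Φ x) (fderiv 𝕜 Φ x z) := by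
    intro z
    rw [fderiv_fun_comp (x := x) hℰ2 hΦd]
    rfl
  have hDA3 : ∀ z, fderiv 𝕜 (fun B => fderiv 𝕜 (fderiv 𝕜 (fderiv 𝕜 ℰ)) (Φ B)) x z =
      fderiv 𝕜 (fderiv 𝕜 (fderiv 𝕜 (fderiv 𝕜 ℰ))) (Φ x) (fderiv 𝕜 Φ x z) := by
    intro z
    rw [fderiv_fun_comp (x := x) hℰ3 hΦd]
    rfl
  -- the derivatives of the factors `Y`, `Z`, `W`
  have hDY : ∀ v z, fderiv 𝕜 (fun B => fderiv 𝕜 Φ B v) x z = fderiv 𝕜 (fderiv 𝕜 Φ) x z v := fun v z =>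
    fderiv_eval_const hΦ1 v z
  have hDZ : ∀ v w z, fderiv 𝕜 (fun B => fderiv 𝕜 (fderiv 𝕜 Φ) B v w) x z =
      fderiv 𝕜 (fderiv 𝕜 (fderiv 𝕜 Φ)) x z v w := by
    intro v w z
    rw [fderiv_eval_const (hZ' v) w z, fderiv_eval_const hΦ2 v z]
  have hDW : ∀ v w y z, fderiv 𝕜 (fun B => fderiv 𝕜 (fderiv 𝕜 (fderiv 𝕜 Φ)) B v w y) x z =
      fderiv 𝕜 (fderiv 𝕜 (fderiv 𝕜 (fderiv 𝕜 Φ))) x z v w y := by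
    intro v w y z
    rw [fderiv_eval_const (hW'' v w) y z, fderiv_eval_const (hW' v) w z,
      fderiv_eval_const (A := fderiv 𝕜 (fderiv 𝕜 (fderiv 𝕜 Φ))) hΦ3 v z]
  -- differentiability of the five terms
  have hT1' : DifferentiableAt 𝕜 (fun B => fderiv 𝕜 (fderiv 𝕜 (fderiv 𝕜 ℰ)) (Φ B) (fderiv 𝕜 Φ B u₂)) x :=
    DifferentiableAt.clm_apply (c := fun B => fderiv 𝕜 (fderiv 𝕜 (fderiv 𝕜 ℰ)) (Φ B)) (u := fun B => fderiv 𝕜 Φ B u₂)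
      hA3 (hY u₂)
  have hT1 : DifferentiableAt 𝕜 (fun B => fderiv 𝕜 (fderiv 𝕜 (fderiv 𝕜 ℰ)) (Φ B) (fderiv 𝕜 Φ B u₂)
      (fderiv 𝕜 Φ B u₃) (fderiv 𝕜 Φ B u₄)) x := (hT1'.clm_apply (hY u₃)).clm_apply (hY u₄)
  have hT2 : DifferentiableAt 𝕜 (fun B => fderiv 𝕜 (fderiv 𝕜 ℰ) (Φ B) (fderiv 𝕜 (fderiv 𝕜 Φ) B u₂ u₃)
      (fderiv 𝕜 Φ B u₄)) x := (hA2.clm_apply (hZ u₂ u₃)).clm_apply (hY u₄)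
  have hT3 : DifferentiableAt 𝕜 (fun B => fderiv 𝕜 (fderiv 𝕜 ℰ) (Φ B) (fderiv 𝕜 Φ B u₂)
      (fderiv 𝕜 (fderiv 𝕜 Φ) B u₃ u₄)) x := (hA2.clm_apply (hY u₂)).clm_apply (hZ u₃ u₄)
  have hT4 : DifferentiableAt 𝕜 (fun B => fderiv 𝕜 (fderiv 𝕜 ℰ) (Φ B) (fderiv 𝕜 Φ B u₃)
      (fderiv 𝕜 (fderiv 𝕜 Φ) B u₂ u₄)) x := (hA2.clm_apply (hY u₃)).clm_apply (hZ u₂ u₄)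
  have hT5 : DifferentiableAt 𝕜 (fun B => fderiv 𝕜 ℰ (Φ B) (fderiv 𝕜 (fderiv 𝕜 (fderiv 𝕜 Φ)) B u₂ u₃ u₄)) x :=
    hA1.clm_apply (hW u₂ u₃ u₄)
  have hS12 : DifferentiableAt 𝕜 (fun B => fderiv 𝕜 (fderiv 𝕜 (fderiv 𝕜 ℰ)) (Φ B) (fderiv 𝕜 Φ B u₂)
      (fderiv 𝕜 Φ B u₃) (fderiv 𝕜 Φ B u₄)
      + fderiv 𝕜 (fderiv 𝕜 ℰ) (Φ B) (fderiv 𝕜 (fderiv 𝕜 Φ) B u₂ u₃) (fderiv 𝕜 Φ B u₄)) x := hT1.add hT2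
  have hS123 : DifferentiableAt 𝕜 (fun B => fderiv 𝕜 (fderiv 𝕜 (fderiv 𝕜 ℰ)) (Φ B) (fderiv 𝕜 Φ B u₂)
      (fderiv 𝕜 Φ B u₃) (fderiv 𝕜 Φ B u₄)
      + fderiv 𝕜 (fderiv 𝕜 ℰ) (Φ B) (fderiv 𝕜 (fderiv 𝕜 Φ) B u₂ u₃) (fderiv 𝕜 Φ B u₄)
      + fderiv 𝕜 (fderiv 𝕜 ℰ) (Φ B) (fderiv 𝕜 Φ B u₂) (fderiv 𝕜 (fderiv 𝕜 Φ) B u₃ u₄)) x := hS12.add hT3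
  have hS1234 : DifferentiableAt 𝕜 (fun B => fderiv 𝕜 (fderiv 𝕜 (fderiv 𝕜 ℰ)) (Φ B) (fderiv 𝕜 Φ B u₂)
      (fderiv 𝕜 Φ B u₃) (fderiv 𝕜 Φ B u₄)
      + fderiv 𝕜 (fderiv 𝕜 ℰ) (Φ B) (fderiv 𝕜 (fderiv 𝕜 Φ) B u₂ u₃) (fderiv 𝕜 Φ B u₄)
      + fderiv 𝕜 (fderiv 𝕜 ℰ) (Φ B) (fderiv 𝕜 Φ B u₂) (fderiv 𝕜 (fderiv 𝕜 Φ) B u₃ u₄)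
      + fderiv 𝕜 (fderiv 𝕜 ℰ) (Φ B) (fderiv 𝕜 Φ B u₃) (fderiv 𝕜 (fderiv 𝕜 Φ) B u₂ u₄)) x := hS123.add hT4
  -- the derivatives of the five terms at `x` in the direction `u₁`
  have e1 : fderiv 𝕜 (fun B => fderiv 𝕜 (fderiv 𝕜 (fderiv 𝕜 ℰ)) (Φ B) (fderiv 𝕜 Φ B u₂) (fderiv 𝕜 Φ B u₃)
      (fderiv 𝕜 Φ B u₄)) x u₁ =
      fderiv 𝕜 (fderiv 𝕜 (fderiv 𝕜 ℰ)) (Φ x) (fderiv 𝕜 Φ x u₂) (fderiv 𝕜 Φ x u₃) (fderiv 𝕜 (fderiv 𝕜 Φ) x u₁ u₄)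
      + fderiv 𝕜 (fderiv 𝕜 (fderiv 𝕜 ℰ)) (Φ x) (fderiv 𝕜 Φ x u₂) (fderiv 𝕜 (fderiv 𝕜 Φ) x u₁ u₃) (fderiv 𝕜 Φ x u₄)
      + fderiv 𝕜 (fderiv 𝕜 (fderiv 𝕜 ℰ)) (Φ x) (fderiv 𝕜 (fderiv 𝕜 Φ) x u₁ u₂) (fderiv 𝕜 Φ x u₃) (fderiv 𝕜 Φ x u₄)
      + fderiv 𝕜 (fderiv 𝕜 (fderiv 𝕜 (fderiv 𝕜 ℰ))) (Φ x) (fderiv 𝕜 Φ x u₁) (fderiv 𝕜 Φ x u₂) (fderiv 𝕜 Φ x u₃)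
          (fderiv 𝕜 Φ x u₄) := by
    rw [fderiv_eval_along₃ hA3 (hY u₂) (hY u₃) (hY u₄) u₁, hDA3, hDY, hDY, hDY]
  have e2 : fderiv 𝕜 (fun B => fderiv 𝕜 (fderiv 𝕜 ℰ) (Φ B) (fderiv 𝕜 (fderiv 𝕜 Φ) B u₂ u₃) (fderiv 𝕜 Φ B u₄)) x u₁ =
      fderiv 𝕜 (fderiv 𝕜 ℰ) (Φ x) (fderiv 𝕜 (fderiv 𝕜 Φ) x u₂ u₃) (fderiv 𝕜 (fderiv 𝕜 Φ) x u₁ u₄)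
      + fderiv 𝕜 (fderiv 𝕜 ℰ) (Φ x) (fderiv 𝕜 (fderiv 𝕜 (fderiv 𝕜 Φ)) x u₁ u₂ u₃) (fderiv 𝕜 Φ x u₄)
      + fderiv 𝕜 (fderiv 𝕜 (fderiv 𝕜 ℰ)) (Φ x) (fderiv 𝕜 Φ x u₁) (fderiv 𝕜 (fderiv 𝕜 Φ) x u₂ u₃)
          (fderiv 𝕜 Φ x u₄) := by
    rw [fderiv_eval_along₂ hA2 (hZ u₂ u₃) (hY u₄) u₁, hDA2, hDY, hDZ]
  have e3 : fderiv 𝕜 (fun B => fderiv 𝕜 (fderiv 𝕜 ℰ) (Φ B) (fderiv 𝕜 Φ B u₂) (fderiv 𝕜 (fderiv 𝕜 Φ) B u₃ u₄)) x u₁ =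
      fderiv 𝕜 (fderiv 𝕜 ℰ) (Φ x) (fderiv 𝕜 Φ x u₂) (fderiv 𝕜 (fderiv 𝕜 (fderiv 𝕜 Φ)) x u₁ u₃ u₄)
      + fderiv 𝕜 (fderiv 𝕜 ℰ) (Φ x) (fderiv 𝕜 (fderiv 𝕜 Φ) x u₁ u₂) (fderiv 𝕜 (fderiv 𝕜 Φ) x u₃ u₄)
      + fderiv 𝕜 (fderiv 𝕜 (fderiv 𝕜 ℰ)) (Φ x) (fderiv 𝕜 Φ x u₁) (fderiv 𝕜 Φ x u₂)
          (fderiv 𝕜 (fderiv 𝕜 Φ) x u₃ u₄) := by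
    rw [fderiv_eval_along₂ hA2 (hY u₂) (hZ u₃ u₄) u₁, hDA2, hDY, hDZ]
  have e4 : fderiv 𝕜 (fun B => fderiv 𝕜 (fderiv 𝕜 ℰ) (Φ B) (fderiv 𝕜 Φ B u₃) (fderiv 𝕜 (fderiv 𝕜 Φ) B u₂ u₄)) x u₁ =
      fderiv 𝕜 (fderiv 𝕜 ℰ) (Φ x) (fderiv 𝕜 Φ x u₃) (fderiv 𝕜 (fderiv 𝕜 (fderiv 𝕜 Φ)) x u₁ u₂ u₄)
      + fderiv 𝕜 (fderiv 𝕜 ℰ) (Φ x) (fderiv 𝕜 (fderiv 𝕜 Φ) x u₁ u₃) (fderiv 𝕜 (fderiv 𝕜 Φ) x u₂ u₄)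
      + fderiv 𝕜 (fderiv 𝕜 (fderiv 𝕜 ℰ)) (Φ x) (fderiv 𝕜 Φ x u₁) (fderiv 𝕜 Φ x u₃)
          (fderiv 𝕜 (fderiv 𝕜 Φ) x u₂ u₄) := by
    rw [fderiv_eval_along₂ hA2 (hY u₃) (hZ u₂ u₄) u₁, hDA2, hDY, hDZ]
  have e5 : fderiv 𝕜 (fun B => fderiv 𝕜 ℰ (Φ B) (fderiv 𝕜 (fderiv 𝕜 (fderiv 𝕜 Φ)) B u₂ u₃ u₄)) x u₁ =
      fderiv 𝕜 ℰ (Φ x) (fderiv 𝕜 (fderiv 𝕜 (fderiv 𝕜 (fderiv 𝕜 Φ))) x u₁ u₂ u₃ u₄)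
      + fderiv 𝕜 (fderiv 𝕜 ℰ) (Φ x) (fderiv 𝕜 Φ x u₁) (fderiv 𝕜 (fderiv 𝕜 (fderiv 𝕜 Φ)) x u₂ u₃ u₄) := by
    rw [fderiv_eval_along hA1 (hW u₂ u₃ u₄) u₁, hDA1, hDW]
  rw [fderiv_fun_add hS1234 hT5, fderiv_fun_add hS123 hT4, fderiv_fun_add hS12 hT3, fderiv_fun_add hT1 hT2]
  simp only [_root_.add_apply]
  rw [e1, e2, e3, e4, e5]
  abel

end ChainRule

section ChartFourth

variable {𝔄 : Type*} [NormedRing 𝔄] [NormedAlgebra ℝ 𝔄] [CompleteSpace 𝔄] {Λ T : Type*} [Fintype Λ] [Fintype T]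
  {V : Type*} [NormedAddCommGroup V] [NormedSpace ℝ V] {F : Type*} [NormedAddCommGroup F] [NormedSpace ℝ F]

-- (the quadruply nested operator space over the iterated `Pi` type: one more level of pending instance synthesis)
set_option maxSynthPendingDepth 3 in
/-- **Fourth-order chain rule at `B = 0` in the chart**: for `f(B) = 𝐄(exp iρB)` and `𝐄` `C⁴` at `1`, with
`Yᵢ = ρuᵢ`, `Zᵢⱼ = ½{ρuᵢ, ρuⱼ}`, `Wᵢⱼₖ = ⅙ Σ_{S₃} ρuᵢ ρuⱼ ρuₖ` (sitewise; `{A, B} = AB + BA` as in print's (4.10)):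
`D⁴f(0)(u₁,u₂,u₃,u₄) = D⁴𝐄(1)(Y₁,Y₂,Y₃,Y₄) + D³𝐄(1)(Z₁₂,Y₃,Y₄) + D³𝐄(1)(Y₂,Z₁₃,Y₄) + D³𝐄(1)(Y₂,Y₃,Z₁₄) +
D³𝐄(1)(Y₁,Z₂₃,Y₄) + D³𝐄(1)(Y₁,Y₂,Z₃₄) + D³𝐄(1)(Y₁,Y₃,Z₂₄) + D²𝐄(1)(W₁₂₃,Y₄) + D²𝐄(1)(Z₂₃,Z₁₄) + D²𝐄(1)(Z₁₂,Z₃₄) +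
D²𝐄(1)(Y₂,W₁₃₄) + D²𝐄(1)(Z₁₃,Z₂₄) + D²𝐄(1)(Y₃,W₁₂₄) + D²𝐄(1)(Y₁,W₂₃₄) + D𝐄(1)[(1/24) Σ_{S₄} ρu₁ ρu₂ ρu₃ ρu₄]`.
[folklore] -/
theorem fderiv_fderiv_fderiv_fderiv_comp_chart_zero_apply {ℰ : (Λ → T → 𝔄) → F} (ρ : V →L[ℝ] 𝔄)
    (hℰ : ContDiffAt ℝ 4 ℰ 1) (u₁ u₂ u₃ u₄ : Λ → T → V) :
    fderiv ℝ (fderiv ℝ (fderiv ℝ (fderiv ℝ (fun B : Λ → T → V => ℰ (fun ν x => exp (ρ (B ν x))))))) 0 u₁ u₂ u₃ u₄ =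
      fderiv ℝ (fderiv ℝ (fderiv ℝ (fderiv ℝ ℰ))) 1 (fun ν x => ρ (u₁ ν x)) (fun ν x => ρ (u₂ ν x)) (fun ν x =>
        ρ (u₃ ν x)) (fun ν x => ρ (u₄ ν x))
      + fderiv ℝ (fderiv ℝ (fderiv ℝ ℰ)) 1 (fun ν x => (2 : ℝ)⁻¹ • (ρ (u₁ ν x) * ρ (u₂ ν x) + ρ (u₂ ν x) *
          ρ (u₁ ν x))) (fun ν x => ρ (u₃ ν x)) (fun ν x => ρ (u₄ ν x))
      + fderiv ℝ (fderiv ℝ (fderiv ℝ ℰ)) 1 (fun ν x => ρ (u₂ ν x)) (fun ν x => (2 : ℝ)⁻¹ • (ρ (u₁ ν x) * ρ (u₃ ν x)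
          + ρ (u₃ ν x) * ρ (u₁ ν x))) (fun ν x => ρ (u₄ ν x))
      + fderiv ℝ (fderiv ℝ (fderiv ℝ ℰ)) 1 (fun ν x => ρ (u₂ ν x)) (fun ν x => ρ (u₃ ν x)) (fun ν x => (2 : ℝ)⁻¹ •
          (ρ (u₁ ν x) * ρ (u₄ ν x) + ρ (u₄ ν x) * ρ (u₁ ν x)))
      + fderiv ℝ (fderiv ℝ (fderiv ℝ ℰ)) 1 (fun ν x => ρ (u₁ ν x)) (fun ν x => (2 : ℝ)⁻¹ • (ρ (u₂ ν x) * ρ (u₃ ν x)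
          + ρ (u₃ ν x) * ρ (u₂ ν x))) (fun ν x => ρ (u₄ ν x))
      + fderiv ℝ (fderiv ℝ (fderiv ℝ ℰ)) 1 (fun ν x => ρ (u₁ ν x)) (fun ν x => ρ (u₂ ν x)) (fun ν x => (2 : ℝ)⁻¹ •
          (ρ (u₃ ν x) * ρ (u₄ ν x) + ρ (u₄ ν x) * ρ (u₃ ν x)))
      + fderiv ℝ (fderiv ℝ (fderiv ℝ ℰ)) 1 (fun ν x => ρ (u₁ ν x)) (fun ν x => ρ (u₃ ν x)) (fun ν x => (2 : ℝ)⁻¹ •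
          (ρ (u₂ ν x) * ρ (u₄ ν x) + ρ (u₄ ν x) * ρ (u₂ ν x)))
      + fderiv ℝ (fderiv ℝ ℰ) 1 (fun ν x => (6 : ℝ)⁻¹ • (ρ (u₁ ν x) * ρ (u₂ ν x) * ρ (u₃ ν x) + ρ (u₁ ν x) *
          ρ (u₃ ν x) * ρ (u₂ ν x) + ρ (u₂ ν x) * ρ (u₁ ν x) * ρ (u₃ ν x) + ρ (u₂ ν x) * ρ (u₃ ν x) * ρ (u₁ ν x) +
          ρ (u₃ ν x) * ρ (u₁ ν x) * ρ (u₂ ν x) + ρ (u₃ ν x) * ρ (u₂ ν x) * ρ (u₁ ν x))) (fun ν x => ρ (u₄ ν x))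
      + fderiv ℝ (fderiv ℝ ℰ) 1 (fun ν x => (2 : ℝ)⁻¹ • (ρ (u₂ ν x) * ρ (u₃ ν x) + ρ (u₃ ν x) * ρ (u₂ ν x)))
          (fun ν x => (2 : ℝ)⁻¹ • (ρ (u₁ ν x) * ρ (u₄ ν x) + ρ (u₄ ν x) * ρ (u₁ ν x)))
      + fderiv ℝ (fderiv ℝ ℰ) 1 (fun ν x => (2 : ℝ)⁻¹ • (ρ (u₁ ν x) * ρ (u₂ ν x) + ρ (u₂ ν x) * ρ (u₁ ν x)))
          (fun ν x => (2 : ℝ)⁻¹ • (ρ (u₃ ν x) * ρ (u₄ ν x) + ρ (u₄ ν x) * ρ (u₃ ν x)))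
      + fderiv ℝ (fderiv ℝ ℰ) 1 (fun ν x => ρ (u₂ ν x)) (fun ν x => (6 : ℝ)⁻¹ • (ρ (u₁ ν x) * ρ (u₃ ν x) *
          ρ (u₄ ν x) + ρ (u₁ ν x) * ρ (u₄ ν x) * ρ (u₃ ν x) + ρ (u₃ ν x) * ρ (u₁ ν x) * ρ (u₄ ν x) + ρ (u₃ ν x) *
          ρ (u₄ ν x) * ρ (u₁ ν x) + ρ (u₄ ν x) * ρ (u₁ ν x) * ρ (u₃ ν x) + ρ (u₄ ν x) * ρ (u₃ ν x) * ρ (u₁ ν x)))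
      + fderiv ℝ (fderiv ℝ ℰ) 1 (fun ν x => (2 : ℝ)⁻¹ • (ρ (u₁ ν x) * ρ (u₃ ν x) + ρ (u₃ ν x) * ρ (u₁ ν x)))
          (fun ν x => (2 : ℝ)⁻¹ • (ρ (u₂ ν x) * ρ (u₄ ν x) + ρ (u₄ ν x) * ρ (u₂ ν x)))
      + fderiv ℝ (fderiv ℝ ℰ) 1 (fun ν x => ρ (u₃ ν x)) (fun ν x => (6 : ℝ)⁻¹ • (ρ (u₁ ν x) * ρ (u₂ ν x) *
          ρ (u₄ ν x) + ρ (u₁ ν x) * ρ (u₄ ν x) * ρ (u₂ ν x) + ρ (u₂ ν x) * ρ (u₁ ν x) * ρ (u₄ ν x) + ρ (u₂ ν x) *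
          ρ (u₄ ν x) * ρ (u₁ ν x) + ρ (u₄ ν x) * ρ (u₁ ν x) * ρ (u₂ ν x) + ρ (u₄ ν x) * ρ (u₂ ν x) * ρ (u₁ ν x)))
      + fderiv ℝ (fderiv ℝ ℰ) 1 (fun ν x => ρ (u₁ ν x)) (fun ν x => (6 : ℝ)⁻¹ • (ρ (u₂ ν x) * ρ (u₃ ν x) *
          ρ (u₄ ν x) + ρ (u₂ ν x) * ρ (u₄ ν x) * ρ (u₃ ν x) + ρ (u₃ ν x) * ρ (u₂ ν x) * ρ (u₄ ν x) + ρ (u₃ ν x) *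
          ρ (u₄ ν x) * ρ (u₂ ν x) + ρ (u₄ ν x) * ρ (u₂ ν x) * ρ (u₃ ν x) + ρ (u₄ ν x) * ρ (u₃ ν x) * ρ (u₂ ν x)))
      + fderiv ℝ ℰ 1 (fun ν x => (24 : ℝ)⁻¹ • (ρ (u₁ ν x) * ρ (u₂ ν x) * ρ (u₃ ν x) * ρ (u₄ ν x) + ρ (u₁ ν x) *
          ρ (u₂ ν x) * ρ (u₄ ν x) * ρ (u₃ ν x) + ρ (u₁ ν x) * ρ (u₃ ν x) * ρ (u₂ ν x) * ρ (u₄ ν x) + ρ (u₁ ν x) *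
          ρ (u₃ ν x) * ρ (u₄ ν x) * ρ (u₂ ν x) + ρ (u₁ ν x) * ρ (u₄ ν x) * ρ (u₂ ν x) * ρ (u₃ ν x) + ρ (u₁ ν x) *
          ρ (u₄ ν x) * ρ (u₃ ν x) * ρ (u₂ ν x) + ρ (u₂ ν x) * ρ (u₁ ν x) * ρ (u₃ ν x) * ρ (u₄ ν x) + ρ (u₂ ν x) *
          ρ (u₁ ν x) * ρ (u₄ ν x) * ρ (u₃ ν x) + ρ (u₂ ν x) * ρ (u₃ ν x) * ρ (u₁ ν x) * ρ (u₄ ν x) + ρ (u₂ ν x) *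
          ρ (u₃ ν x) * ρ (u₄ ν x) * ρ (u₁ ν x) + ρ (u₂ ν x) * ρ (u₄ ν x) * ρ (u₁ ν x) * ρ (u₃ ν x) + ρ (u₂ ν x) *
          ρ (u₄ ν x) * ρ (u₃ ν x) * ρ (u₁ ν x) + ρ (u₃ ν x) * ρ (u₁ ν x) * ρ (u₂ ν x) * ρ (u₄ ν x) + ρ (u₃ ν x) *
          ρ (u₁ ν x) * ρ (u₄ ν x) * ρ (u₂ ν x) + ρ (u₃ ν x) * ρ (u₂ ν x) * ρ (u₁ ν x) * ρ (u₄ ν x) + ρ (u₃ ν x) *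
          ρ (u₂ ν x) * ρ (u₄ ν x) * ρ (u₁ ν x) + ρ (u₃ ν x) * ρ (u₄ ν x) * ρ (u₁ ν x) * ρ (u₂ ν x) + ρ (u₃ ν x) *
          ρ (u₄ ν x) * ρ (u₂ ν x) * ρ (u₁ ν x) + ρ (u₄ ν x) * ρ (u₁ ν x) * ρ (u₂ ν x) * ρ (u₃ ν x) + ρ (u₄ ν x) *
          ρ (u₁ ν x) * ρ (u₃ ν x) * ρ (u₂ ν x) + ρ (u₄ ν x) * ρ (u₂ ν x) * ρ (u₁ ν x) * ρ (u₃ ν x) + ρ (u₄ ν x) *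
          ρ (u₂ ν x) * ρ (u₃ ν x) * ρ (u₁ ν x) + ρ (u₄ ν x) * ρ (u₃ ν x) * ρ (u₁ ν x) * ρ (u₂ ν x) + ρ (u₄ ν x) *
          ρ (u₃ ν x) * ρ (u₂ ν x) * ρ (u₁ ν x))) := by
  set Φ : (Λ → T → V) → Λ → T → 𝔄 := fun B ν x => exp (ρ (B ν x)) with hΦ
  show fderiv ℝ (fderiv ℝ (fderiv ℝ (fderiv ℝ (fun B : Λ → T → V => ℰ (Φ B))))) 0 u₁ u₂ u₃ u₄ = _
  have hC : ContDiff ℝ 4 Φ := contDiff_chart ρ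
  have hΦ0 : Φ 0 = 1 := chart_zero ρ
  have hΦ1 : ∀ u : Λ → T → V, fderiv ℝ Φ 0 u = fun ν x => ρ (u ν x) := fderiv_chart_zero_apply ρ
  have hΦ2 : ∀ u w : Λ → T → V, fderiv ℝ (fderiv ℝ Φ) 0 u w =
      fun ν x => (2 : ℝ)⁻¹ • (ρ (u ν x) * ρ (w ν x) + ρ (w ν x) * ρ (u ν x)) :=
    fderiv_fderiv_chart_zero_apply ρ
  have hΦ3 : ∀ u v w : Λ → T → V, fderiv ℝ (fderiv ℝ (fderiv ℝ Φ)) 0 u v w =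
      fun ν x => (6 : ℝ)⁻¹ • (ρ (u ν x) * ρ (v ν x) * ρ (w ν x) + ρ (u ν x) * ρ (w ν x) * ρ (v ν x) +
        ρ (v ν x) * ρ (u ν x) * ρ (w ν x) + ρ (v ν x) * ρ (w ν x) * ρ (u ν x) +
        ρ (w ν x) * ρ (u ν x) * ρ (v ν x) + ρ (w ν x) * ρ (v ν x) * ρ (u ν x)) :=
    fderiv_fderiv_fderiv_chart_zero_apply ρ
  have hΦ4 : ∀ u v w z : Λ → T → V, fderiv ℝ (fderiv ℝ (fderiv ℝ (fderiv ℝ Φ))) 0 u v w z =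
      fun ν x => (24 : ℝ)⁻¹ • (ρ (u ν x) * ρ (v ν x) * ρ (w ν x) * ρ (z ν x) + ρ (u ν x) * ρ (v ν x) * ρ (z ν x) *
        ρ (w ν x) + ρ (u ν x) * ρ (w ν x) * ρ (v ν x) * ρ (z ν x) + ρ (u ν x) * ρ (w ν x) * ρ (z ν x) * ρ (v ν x) +
        ρ (u ν x) * ρ (z ν x) * ρ (v ν x) * ρ (w ν x) + ρ (u ν x) * ρ (z ν x) * ρ (w ν x) * ρ (v ν x) + ρ (v ν x) *
        ρ (u ν x) * ρ (w ν x) * ρ (z ν x) + ρ (v ν x) * ρ (u ν x) * ρ (z ν x) * ρ (w ν x) + ρ (v ν x) * ρ (w ν x) *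
        ρ (u ν x) * ρ (z ν x) + ρ (v ν x) * ρ (w ν x) * ρ (z ν x) * ρ (u ν x) + ρ (v ν x) * ρ (z ν x) * ρ (u ν x) *
        ρ (w ν x) + ρ (v ν x) * ρ (z ν x) * ρ (w ν x) * ρ (u ν x) + ρ (w ν x) * ρ (u ν x) * ρ (v ν x) * ρ (z ν x) +
        ρ (w ν x) * ρ (u ν x) * ρ (z ν x) * ρ (v ν x) + ρ (w ν x) * ρ (v ν x) * ρ (u ν x) * ρ (z ν x) + ρ (w ν x) *
        ρ (v ν x) * ρ (z ν x) * ρ (u ν x) + ρ (w ν x) * ρ (z ν x) * ρ (u ν x) * ρ (v ν x) + ρ (w ν x) * ρ (z ν x) *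
        ρ (v ν x) * ρ (u ν x) + ρ (z ν x) * ρ (u ν x) * ρ (v ν x) * ρ (w ν x) + ρ (z ν x) * ρ (u ν x) * ρ (w ν x) *
        ρ (v ν x) + ρ (z ν x) * ρ (v ν x) * ρ (u ν x) * ρ (w ν x) + ρ (z ν x) * ρ (v ν x) * ρ (w ν x) * ρ (u ν x) +
        ρ (z ν x) * ρ (w ν x) * ρ (u ν x) * ρ (v ν x) + ρ (z ν x) * ρ (w ν x) * ρ (v ν x) * ρ (u ν x)) :=
    fderiv_fderiv_fderiv_fderiv_chart_zero_apply ρ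
  have hℰ' : ContDiffAt ℝ 4 ℰ (Φ 0) := by
    rw [hΦ0]
    exact hℰ
  rw [fderiv_fderiv_fderiv_fderiv_comp_apply hC.contDiffAt hℰ' u₁ u₂ u₃ u₄]
  simp only [hΦ0, hΦ1, hΦ2, hΦ3, hΦ4]

end ChartFourth

/-! ## §3. [folklore] The pointwise identities in the free algebra: the `D²𝐄(1)`-slots and the `D𝐄(1)`-slot -/

section Algebra

variable {𝔄 : Type*} [Ring 𝔄] [Algebra ℝ 𝔄]

/-- Cancelling a non-zero real scalar. [folklore] -/
private theorem eq_of_smul_eq {c : ℝ} (hc : c ≠ 0) {a b : 𝔄} (h : c • a = c • b) : a = b := by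
  rw [← inv_smul_smul₀ hc a, ← inv_smul_smul₀ hc b, h]

/-- `R(U, V) + Q(U, V) = 0`: the residual `(1/12)((U[P,V] − [P,V]U) + (V[P,U] − [P,U]V))` of (4.11) at `B = 0`
(`…B12WardSecond415.residual_eq_twelfth_double_commutators`, print's `−k₂{iad_{B₁}, iad_{B₂}}∂λ` moved to the
right) is minus print's `k₂{iad_U, iad_V}P = (1/12)([U,[V,P]] + [V,[U,P]])`, `P = N − M`. [folklore] -/
theorem twelfth_residual_add_anticommutator_eq_zero (M N U V : 𝔄) :
      (12 : ℝ)⁻¹ • ((U * ((N - M) * V - V * (N - M)) - ((N - M) * V - V * (N - M)) * U) + (V * ((N - M) * U -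
      U * (N - M)) - ((N - M) * U - U * (N - M)) * V)) + ((12 : ℝ)⁻¹ • ((U * (V * (N - M) - (N - M) * V) -
      (V * (N - M) - (N - M) * V) * U) + (V * (U * (N - M) - (N - M) * U) - (U * (N - M) - (N - M) * U) * V))) = 0 := by
  rw [← smul_add]
  refine (congrArg ((12 : ℝ)⁻¹ • ·) ?_).trans (smul_zero _)
  noncomm_ring

/-- **The `D𝐄(1)`-slot of (4.12) at `B = 0` VANISHES IDENTICALLY** (`k₃ = 0`): with `S₃ = ⅙ Σ_{S₃}`,
`S₄ = (1/24) Σ_{S₄}`, `J = ½{·, ·}`, `L X = MX − XN`, `c_V = [M, V] − ½[V, P]`, `q_{UV} = (1/12)([U,[V,P]] + [V,[U,P]])`,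
`P = N − M`:  `L S₃(V₁,V₂,V₃) + S₄(V₁,V₂,V₃,P) − S₃(V₁,V₂,c_{V₃}) − S₃(V₁,V₃,c_{V₂}) − S₃(V₂,V₃,c_{V₁}) + J(V₁,q_{V₂V₃})
+ J(V₂,q_{V₁V₃}) + J(V₃,q_{V₁V₂}) = 0` in every ring — the coefficient of `⟨(δ/δB)𝐄(1), …⟩` in (4.12) at `B = 0` is
the `z³`-coefficient `k₃` of `g⁻¹(z) = −z/(e^{−z} − 1) = 1 + ½z + (1/12)z² + 0·z³ − (1/720)z⁴ + …`, which is ZERO, here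
PRODUCED by the kernel from `1/2!`, `1/3!`, `1/4!` of the exponential series. [folklore] -/
theorem residual4_eq_zero (M N V₁ V₂ V₃ : 𝔄) :
      M * ((6 : ℝ)⁻¹ • (V₁ * V₂ * V₃ + V₁ * V₃ * V₂ + V₂ * V₁ * V₃ + V₂ * V₃ * V₁ + V₃ * V₁ * V₂ +
      V₃ * V₂ * V₁)) - ((6 : ℝ)⁻¹ • (V₁ * V₂ * V₃ + V₁ * V₃ * V₂ + V₂ * V₁ * V₃ + V₂ * V₃ * V₁ + V₃ * V₁ * V₂ +
      V₃ * V₂ * V₁)) * N + ((24 : ℝ)⁻¹ • (V₁ * V₂ * V₃ * (N - M) + V₁ * V₂ * (N - M) * V₃ + V₁ * V₃ * V₂ * (N -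
      M) + V₁ * V₃ * (N - M) * V₂ + V₁ * (N - M) * V₂ * V₃ + V₁ * (N - M) * V₃ * V₂ + V₂ * V₁ * V₃ * (N - M) +
      V₂ * V₁ * (N - M) * V₃ + V₂ * V₃ * V₁ * (N - M) + V₂ * V₃ * (N - M) * V₁ + V₂ * (N - M) * V₁ * V₃ +
      V₂ * (N - M) * V₃ * V₁ + V₃ * V₁ * V₂ * (N - M) + V₃ * V₁ * (N - M) * V₂ + V₃ * V₂ * V₁ * (N - M) +
      V₃ * V₂ * (N - M) * V₁ + V₃ * (N - M) * V₁ * V₂ + V₃ * (N - M) * V₂ * V₁ + (N - M) * V₁ * V₂ * V₃ + (N -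
      M) * V₁ * V₃ * V₂ + (N - M) * V₂ * V₁ * V₃ + (N - M) * V₂ * V₃ * V₁ + (N - M) * V₃ * V₁ * V₂ + (N -
      M) * V₃ * V₂ * V₁)) - ((6 : ℝ)⁻¹ • (V₁ * V₂ * ((M * V₃ - V₃ * M) - ((2 : ℝ)⁻¹ • (V₃ * (N - M) - (N -
      M) * V₃))) + V₁ * ((M * V₃ - V₃ * M) - ((2 : ℝ)⁻¹ • (V₃ * (N - M) - (N - M) * V₃))) * V₂ +
      V₂ * V₁ * ((M * V₃ - V₃ * M) - ((2 : ℝ)⁻¹ • (V₃ * (N - M) - (N - M) * V₃))) + V₂ * ((M * V₃ - V₃ * M) -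
      ((2 : ℝ)⁻¹ • (V₃ * (N - M) - (N - M) * V₃))) * V₁ + ((M * V₃ - V₃ * M) - ((2 : ℝ)⁻¹ • (V₃ * (N - M) -
      (N - M) * V₃))) * V₁ * V₂ + ((M * V₃ - V₃ * M) - ((2 : ℝ)⁻¹ • (V₃ * (N - M) - (N -
      M) * V₃))) * V₂ * V₁)) - ((6 : ℝ)⁻¹ • (V₁ * V₃ * ((M * V₂ - V₂ * M) - ((2 : ℝ)⁻¹ • (V₂ * (N - M) - (N -
      M) * V₂))) + V₁ * ((M * V₂ - V₂ * M) - ((2 : ℝ)⁻¹ • (V₂ * (N - M) - (N - M) * V₂))) * V₃ +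
      V₃ * V₁ * ((M * V₂ - V₂ * M) - ((2 : ℝ)⁻¹ • (V₂ * (N - M) - (N - M) * V₂))) + V₃ * ((M * V₂ - V₂ * M) -
      ((2 : ℝ)⁻¹ • (V₂ * (N - M) - (N - M) * V₂))) * V₁ + ((M * V₂ - V₂ * M) - ((2 : ℝ)⁻¹ • (V₂ * (N - M) -
      (N - M) * V₂))) * V₁ * V₃ + ((M * V₂ - V₂ * M) - ((2 : ℝ)⁻¹ • (V₂ * (N - M) - (N -
      M) * V₂))) * V₃ * V₁)) - ((6 : ℝ)⁻¹ • (V₂ * V₃ * ((M * V₁ - V₁ * M) - ((2 : ℝ)⁻¹ • (V₁ * (N - M) - (N -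
      M) * V₁))) + V₂ * ((M * V₁ - V₁ * M) - ((2 : ℝ)⁻¹ • (V₁ * (N - M) - (N - M) * V₁))) * V₃ +
      V₃ * V₂ * ((M * V₁ - V₁ * M) - ((2 : ℝ)⁻¹ • (V₁ * (N - M) - (N - M) * V₁))) + V₃ * ((M * V₁ - V₁ * M) -
      ((2 : ℝ)⁻¹ • (V₁ * (N - M) - (N - M) * V₁))) * V₂ + ((M * V₁ - V₁ * M) - ((2 : ℝ)⁻¹ • (V₁ * (N - M) -
      (N - M) * V₁))) * V₂ * V₃ + ((M * V₁ - V₁ * M) - ((2 : ℝ)⁻¹ • (V₁ * (N - M) - (N -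
      M) * V₁))) * V₃ * V₂)) + ((2 : ℝ)⁻¹ • (V₁ * ((12 : ℝ)⁻¹ • ((V₂ * (V₃ * (N - M) - (N - M) * V₃) -
      (V₃ * (N - M) - (N - M) * V₃) * V₂) + (V₃ * (V₂ * (N - M) - (N - M) * V₂) - (V₂ * (N - M) - (N -
      M) * V₂) * V₃))) + ((12 : ℝ)⁻¹ • ((V₂ * (V₃ * (N - M) - (N - M) * V₃) - (V₃ * (N - M) - (N -
      M) * V₃) * V₂) + (V₃ * (V₂ * (N - M) - (N - M) * V₂) - (V₂ * (N - M) - (N - M) * V₂) * V₃))) * V₁)) +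
      ((2 : ℝ)⁻¹ • (V₂ * ((12 : ℝ)⁻¹ • ((V₁ * (V₃ * (N - M) - (N - M) * V₃) - (V₃ * (N - M) - (N -
      M) * V₃) * V₁) + (V₃ * (V₁ * (N - M) - (N - M) * V₁) - (V₁ * (N - M) - (N - M) * V₁) * V₃))) +
      ((12 : ℝ)⁻¹ • ((V₁ * (V₃ * (N - M) - (N - M) * V₃) - (V₃ * (N - M) - (N - M) * V₃) * V₁) +
      (V₃ * (V₁ * (N - M) - (N - M) * V₁) - (V₁ * (N - M) - (N - M) * V₁) * V₃))) * V₂)) +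
      ((2 : ℝ)⁻¹ • (V₃ * ((12 : ℝ)⁻¹ • ((V₁ * (V₂ * (N - M) - (N - M) * V₂) - (V₂ * (N - M) - (N -
      M) * V₂) * V₁) + (V₂ * (V₁ * (N - M) - (N - M) * V₁) - (V₁ * (N - M) - (N - M) * V₁) * V₂))) +
      ((12 : ℝ)⁻¹ • ((V₁ * (V₂ * (N - M) - (N - M) * V₂) - (V₂ * (N - M) - (N - M) * V₂) * V₁) +
      (V₂ * (V₁ * (N - M) - (N - M) * V₁) - (V₁ * (N - M) - (N - M) * V₁) * V₂))) * V₃)) = 0 := by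
  have h24 : (24 : ℝ) ≠ 0 := by norm_num
  apply eq_of_smul_eq h24
  rw [smul_zero]
  simp only [smul_add, smul_sub, mul_add, add_mul, mul_sub, sub_mul, mul_smul_comm, smul_mul_assoc, smul_smul,
    smul_inv_smul₀ h24]
  norm_num
  simp only [ofNat_smul_eq_nsmul]
  noncomm_ring

/-- **The `D²𝐄(1)(Vᵢ, ·)`-slot of (4.12) at `B = 0`**: with `J = ½{U, V}`, `S₃ = ⅙ Σ_{S₃}`, `c_V = [M, V] − ½[V, P]`,
`q_{UV} = (1/12)([U,[V,P]] + [V,[U,P]])` (print's `k₂{iad_U, iad_V}P`, `k₂ = 1/12`), `P = N − M`: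
`(M J − J N) + S₃(U, V, P) − ½{U, c_V} − ½{V, c_U} + q_{UV} = 0` in every ring — the parent's
`…B12WardSecond415.residual_eq_twelfth_double_commutators` (the residual is `(1/12)((U[P,V] − [P,V]U) + (V[P,U] −
[P,U]V))`) plus `twelfth_residual_add_anticommutator_eq_zero`; proved directly by clearing denominators. [folklore] -/
theorem residual3_eq_zero (M N U V : 𝔄) :
    M * ((2 : ℝ)⁻¹ • (U * V + V * U)) - ((2 : ℝ)⁻¹ • (U * V + V * U)) * N + ((6 : ℝ)⁻¹ • (U * V * (N - M) + U *
      (N - M) * V + V * U * (N - M) + V * (N - M) * U + (N - M) * U * V + (N - M) * V * U)) - ((2 : ℝ)⁻¹ • (U * ((M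
      * V - V * M) - ((2 : ℝ)⁻¹ • (V * (N - M) - (N - M) * V))) + ((M * V - V * M) - ((2 : ℝ)⁻¹ • (V * (N - M) -
      (N - M) * V))) * U)) - ((2 : ℝ)⁻¹ • (V * ((M * U - U * M) - ((2 : ℝ)⁻¹ • (U * (N - M) - (N - M) * U))) + ((M *
      U - U * M) - ((2 : ℝ)⁻¹ • (U * (N - M) - (N - M) * U))) * V)) + ((12 : ℝ)⁻¹ • ((U * (V * (N - M) - (N - M) *
      V) - (V * (N - M) - (N - M) * V) * U) + (V * (U * (N - M) - (N - M) * U) - (U * (N - M) - (N - M) * U) * V)))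
      = 0 := by
  have h12 : (12 : ℝ) ≠ 0 := by norm_num
  apply eq_of_smul_eq h12
  rw [smul_zero]
  simp only [smul_add, smul_sub, mul_add, add_mul, mul_sub, sub_mul, mul_smul_comm, smul_mul_assoc, smul_smul,
    smul_inv_smul₀ h12]
  norm_num
  simp only [ofNat_smul_eq_nsmul]
  noncomm_ring

end Algebra

/-! ## §4. (4.7) ⇒ (4.12) at `B = 0` in the ambient `V`-coordinates -/

section WardThirdAmbient

variable {𝔄 : Type*} [NormedRing 𝔄] [NormedAlgebra ℝ 𝔄] [CompleteSpace 𝔄] {Λ T : Type*} [Fintype Λ] [Fintype T]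
  [AddCommGroup T] {F : Type*} [NormedAddCommGroup F] [NormedSpace ℝ F]

-- The triply nested operator space over the iterated `Pi` type needs more levels of pending instance synthesis than
-- Lean's default (as in Mathlib's `OperatorNorm` files and the parent's `third_one_apply_grad_eq`).
set_option maxSynthPendingDepth 3 in
/-- **(4.12) at `B = 0` in `V`-coordinates, WITHOUT (4.14)** (p. 283 «From this we derive a whole sequence of
identities by differentiations with respect to B. For our purpose it is enough to consider expressions with four
derivatives at most.», (4.12) p. 284): if `𝐄` is `C⁴` at `V = 1` and invariant under the gauge flow of `Λ` ((4.7))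
near `V = 1` for small `t`, then for all directions `U₁`, `U₂`, `U₃`
`D⁴𝐄(1)(U₁, U₂, U₃, ∂Λ) = D³𝐄(1)(U₁, U₂, L_Λ U₃) + D³𝐄(1)(U₁, U₃, L_Λ U₂) + D³𝐄(1)(U₂, U₃, L_Λ U₁)`,
`(L_Λ U)(b) = Λ(b₋)U(b) − U(b)Λ(b₊)` — the THIRD `W`-derivative at `1` of the identically vanishing (4.9)
`W ↦ D𝐄(W)[Λ₋W − WΛ₊]` (`…B12Ward414.ward_third_order` with the affine generator field `U ↦ L_Λ(1 + U)`: value `−∂Λ`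
at `U = 0`, derivative `L_Λ`, second and third derivatives `0`). [cite: Balaban1987RG1, (4.7) p.282, (4.9) p.283, (4.12) p.284] -/
theorem fourth_one_apply_grad_eq {ℰ : (Λ → T → 𝔄) → F} (e : Λ → T) (hℰ : ContDiffAt ℝ 4 ℰ 1) (Lam : T → 𝔄)
    (h47 : ∀ᶠ W in 𝓝 (1 : Λ → T → 𝔄), ∀ᶠ t in 𝓝 (0 : ℝ),
      ℰ (fun ν x => exp (t • Lam x) * W ν x * exp (-(t • Lam (x + e ν)))) = ℰ W) (U₁ U₂ U₃ : Λ → T → 𝔄) :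
    fderiv ℝ (fderiv ℝ (fderiv ℝ (fderiv ℝ ℰ))) 1 U₁ U₂ U₃ (fun ν y => Lam (y + e ν) - Lam y) =
      fderiv ℝ (fderiv ℝ (fderiv ℝ ℰ)) 1 U₁ U₂ (fun ν x => Lam x * U₃ ν x - U₃ ν x * Lam (x + e ν)) +
      fderiv ℝ (fderiv ℝ (fderiv ℝ ℰ)) 1 U₁ U₃ (fun ν x => Lam x * U₂ ν x - U₂ ν x * Lam (x + e ν)) +
      fderiv ℝ (fderiv ℝ (fderiv ℝ ℰ)) 1 U₂ U₃ (fun ν x => Lam x * U₁ ν x - U₁ ν x * Lam (x + e ν)) := by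
  obtain ⟨L, hL⟩ := exists_generatorCLM e Lam
  set ℰ₁ : (Λ → T → 𝔄) → F := fun U => ℰ (1 + U) with hℰ₁
  have hD : ∀ U, fderiv ℝ ℰ₁ U = fderiv ℝ ℰ (1 + U) := fun U => fderiv_comp_add_left 1
  have hD' : fderiv ℝ ℰ₁ = fun U => fderiv ℝ ℰ (1 + U) := funext hD
  have hDD' : fderiv ℝ (fderiv ℝ ℰ₁) = fun U => fderiv ℝ (fderiv ℝ ℰ) (1 + U) := by
    rw [hD']
    funext U
    exact fderiv_comp_add_left (𝕜 := ℝ) (f := fderiv ℝ ℰ) (x := U) (1 : Λ → T → 𝔄)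
  have hDDD' : fderiv ℝ (fderiv ℝ (fderiv ℝ ℰ₁)) = fun U => fderiv ℝ (fderiv ℝ (fderiv ℝ ℰ)) (1 + U) := by
    rw [hDD']
    funext U
    exact fderiv_comp_add_left (𝕜 := ℝ) (f := fderiv ℝ (fderiv ℝ ℰ)) (x := U) (1 : Λ → T → 𝔄)
  have hDDD : fderiv ℝ (fderiv ℝ (fderiv ℝ ℰ₁)) 0 = fderiv ℝ (fderiv ℝ (fderiv ℝ ℰ)) 1 := by
    rw [hDDD']
    simp only [add_zero]
  have hDDDD : fderiv ℝ (fderiv ℝ (fderiv ℝ (fderiv ℝ ℰ₁))) 0 = fderiv ℝ (fderiv ℝ (fderiv ℝ (fderiv ℝ ℰ))) 1 := by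
    rw [hDDD']
    have h := fderiv_comp_add_left (𝕜 := ℝ) (f := fderiv ℝ (fderiv ℝ (fderiv ℝ ℰ))) (x := (0 : Λ → T → 𝔄))
      (1 : Λ → T → 𝔄)
    rwa [add_zero] at h
  have h1C : ContDiffAt ℝ 4 ℰ₁ 0 := by
    have h : ContDiffAt ℝ 4 ℰ ((fun U : Λ → T → 𝔄 => 1 + U) 0) := by simpa using hℰ
    exact h.comp 0 (contDiffAt_const.add contDiffAt_id)
  have hdiff : ∀ᶠ W in 𝓝 (1 : Λ → T → 𝔄), DifferentiableAt ℝ ℰ W := by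
    filter_upwards [hℰ.eventually (by simp)] with W hW
    exact hW.differentiableAt (by simp)
  have hc : Tendsto (fun U : Λ → T → 𝔄 => 1 + U) (𝓝 0) (𝓝 1) := by
    have hcts : Continuous (fun U : Λ → T → 𝔄 => 1 + U) := by fun_prop
    simpa using hcts.tendsto 0
  have hX : ContDiffAt ℝ 3 (fun U : Λ → T → 𝔄 => L (1 + U)) 0 := by
    have h : ContDiffAt ℝ 3 (L : (Λ → T → 𝔄) → (Λ → T → 𝔄)) ((fun U : Λ → T → 𝔄 => 1 + U) 0) :=
      L.contDiff.contDiffAt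
    exact h.comp 0 (contDiffAt_const.add contDiffAt_id)
  have hXD' : fderiv ℝ (fun U : Λ → T → 𝔄 => L (1 + U)) = fun _ => L := by
    funext U
    rw [fderiv_comp_add_left, L.fderiv]
  have hXD : fderiv ℝ (fun U : Λ → T → 𝔄 => L (1 + U)) 0 = L := by
    rw [hXD']
  have hXDD' : fderiv ℝ (fderiv ℝ (fun U : Λ → T → 𝔄 => L (1 + U))) = fun _ => 0 := by
    rw [hXD']
    funext U
    simp
  have hXDD : fderiv ℝ (fderiv ℝ (fun U : Λ → T → 𝔄 => L (1 + U))) 0 = 0 := by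
    rw [hXDD']
  have hXDDD : fderiv ℝ (fderiv ℝ (fderiv ℝ (fun U : Λ → T → 𝔄 => L (1 + U)))) 0 = 0 := by
    rw [hXDD']
    simp
  have hL1 : L 1 = -(fun ν y => Lam (y + e ν) - Lam y) := by
    rw [hL]
    funext ν y
    simp
  have hinv : ∀ᶠ U in 𝓝 (0 : Λ → T → 𝔄), fderiv ℝ ℰ₁ U (L (1 + U)) = 0 := by
    filter_upwards [hc.eventually (hdiff.and h47)] with U hU
    rw [hD, hL]
    exact fderiv_apply_gaugeGenerator_eq_zero e Lam hU.1 hU.2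
  have h := ward_third_order (𝕜 := ℝ) h1C hX hinv U₁ U₂ U₃
  simp only [add_zero, hXD, hXDD, hXDDD, _root_.zero_apply, map_zero] at h
  rw [hDDDD, hDDD, hL1, map_neg, add_assoc, add_assoc, neg_add_eq_zero] at h
  rw [h, hL, hL, hL, ← add_assoc]

end WardThirdAmbient

/-! ## §5. (4.7) ⇒ (4.12) = (4.15)₃ AT `B = 0` IN THE CHART — `k₂ = 1/12`, `k₃ = 0`, no (4.14) needed -/

section FourFifteenThree

variable {𝔄 : Type*} [NormedRing 𝔄] [NormedAlgebra ℝ 𝔄] [CompleteSpace 𝔄] {Λ T : Type*} [Fintype Λ] [Fintype T]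
  [AddCommGroup T] {V : Type*} [NormedAddCommGroup V] [NormedSpace ℝ V] {F : Type*} [NormedAddCommGroup F]
  [NormedSpace ℝ F]

/-- Regrouping of the forty-odd terms of (4.12) at `B = 0` after the chain rules into the three `D²𝐄(1)(ρuᵢ, ·)`-slots
and the `D𝐄(1)`-slot (the `D³𝐄(1)`-terms cancel on the nose). [folklore] -/
private theorem comb4 {A : Type*} [AddCommGroup A]
    {d1 d2 d3 d4 d5 d6 e1 e2 e3 e4 e5 e6 f1 f2 f3 f4 f5 f6 g1 g2 h1 h2 h3 h4 h5 h6 k1 k2 k3 m1 m2 m3 n1 n2 n3 : A}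
    (H₁ : e5 + f6 - h1 - h3 + m1 = 0) (H₂ : e3 + f3 - h2 - h5 + m2 = 0) (H₃ : e2 + f5 - h4 - h6 + m3 = 0)
    (H₄ : g1 + g2 - k1 - k2 - k3 + n1 + n2 + n3 = 0) :
    d1 + d2 + d3 + (e1 + e2) + (e3 + e4) + d4 + (e5 + e6) + d5 + d6 + g1 + f1 + f2 + f3 + f4 + f5 + f6 + g2
      - (d1 + d5 + (e1 + f2) + h1 + h2 + k1) - (d2 + d6 + (e4 + f4) + h3 + h4 + k2)
      - (d3 + d4 + (e6 + f1) + h5 + h6 + k3) + (m1 + n1) + (m2 + n2) + (m3 + n3) = 0 := by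
  calc _ = (e5 + f6 - h1 - h3 + m1) + (e3 + f3 - h2 - h5 + m2) + (e2 + f5 - h4 - h6 + m3)
        + (g1 + g2 - k1 - k2 - k3 + n1 + n2 + n3) := by abel
    _ = 0 := by rw [H₁, H₂, H₃, H₄, add_zero, add_zero, add_zero]

-- (the quadruply nested operator space over the iterated `Pi` type: one more level of pending instance synthesis)
set_option maxSynthPendingDepth 3 in
/-- **(4.7) ⇒ (4.12) = (4.15)₃ AT `B = 0` IN THE CHART, WITHOUT (4.14)** (p. 284: (4.12) «⟨(δ⁴/δB⁴)𝐄(exp iB),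
iad_{λ₋}B − g⁻¹(iad_B)∂λ, B₁,B₂,B₃⟩ + ⟨(δ³/δB³)𝐄(exp iB), iad_{λ₋}B₃ − ½iad_{B₃}∂λ − k₂{iad_{B₃}, iad_B}∂λ − …,
B₁,B₂⟩ + (B₁↔B₃) + (B₂↔B₃) + ⟨(δ²/δB²)𝐄(exp iB), −k₂{iad_{B₂}, iad_{B₃}}∂λ, B₁⟩ + (B₁↔B₂) + (B₁↔B₃) +
⟨(δ/δB)𝐄(exp iB), …⟩ = 0.»; (4.15), third identity: «⟨(δ⁴/δB⁴)𝐄(1), B₁,B₂,B₃, ∂λ⟩ − ⟨(δ³/δB³)𝐄(1), B₁,B₂,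
i[λ₋,B₃] − ½i[B₃,∂λ]⟩ − (B₃↔B₂) − (B₃↔B₁) + ⟨(δ²/δB²)𝐄(1), B₁, k₂{iad_{B₂}, iad_{B₃}}∂λ⟩ + (B₁↔B₂) + (B₁↔B₃) = 0,
[…] for an arbitrary gauge function λ, and arbitrary gauge fields B₁, B₂, B₃.»): for `𝐄` `C⁴` at `1` and gauge
invariant (4.7) near `1` under the flows of ONE `𝔤`-valued `λ`, `f(B) = 𝐄(exp ρB)`, `𝔤`-valued `B₁, B₂, B₃ = u₁, u₂,
u₃`, representatives `cᵢ` of `i[λ₋, Bᵢ] − ½i[Bᵢ, ∂λ]` (`hcᵢ`) and `q_{jk}` of `k₂{iad_{B_j}, iad_{B_k}}∂λ` WITH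
`k₂ = 1/12` (`hq_{jk}`): `D⁴f(0)(B₁, B₂, B₃, ∂λ) − D³f(0)(B₁, B₂, c₃) − D³f(0)(B₁, B₃, c₂) − D³f(0)(B₂, B₃, c₁) +
D²f(0)(B₁, q₂₃) + D²f(0)(B₂, q₁₃) + D²f(0)(B₃, q₁₂) = 0` (every slot in its natural order; print's literal exchanged
orders in `…_literal`).  NO (4.14), NO semisimplicity: the `D𝐄(1)`-slot vanishes identically (`residual4_eq_zero`,
`k₃ = 0`).  Proof: chain rules (§2, parent, grandparent) + §4 + the parent's (4.11)|₀ and the grandparent's (4.10)|₀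
in ambient coordinates for the composite slots + §3 + regrouping.
[cite: Balaban1987RG1, (4.7) p.282, (4.8) p.283, (4.12) p.284, (4.15) p.284] -/
theorem fourth_chart_apply_grad_eq_zero {ℰ : (Λ → T → 𝔄) → F} (e : Λ → T) (ρ : V →L[ℝ] 𝔄)
    (hℰ : ContDiffAt ℝ 4 ℰ 1) (lam : T → V) (h47 : ∀ᶠ W in 𝓝 (1 : Λ → T → 𝔄), ∀ᶠ t in 𝓝 (0 : ℝ),
      ℰ (fun ν x => exp (t • ρ (lam x)) * W ν x * exp (-(t • ρ (lam (x + e ν))))) = ℰ W)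
    (u₁ u₂ u₃ c₁ c₂ c₃ q₂₃ q₁₃ q₁₂ : Λ → T → V)
    (hc₁ : ∀ ν x, ρ (c₁ ν x) = (ρ (lam x) * ρ (u₁ ν x) - ρ (u₁ ν x) * ρ (lam x)) -
      (2 : ℝ)⁻¹ • (ρ (u₁ ν x) * (ρ (lam (x + e ν)) - ρ (lam x)) - (ρ (lam (x + e ν)) - ρ (lam x)) * ρ (u₁ ν x)))
    (hc₂ : ∀ ν x, ρ (c₂ ν x) = (ρ (lam x) * ρ (u₂ ν x) - ρ (u₂ ν x) * ρ (lam x)) -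
      (2 : ℝ)⁻¹ • (ρ (u₂ ν x) * (ρ (lam (x + e ν)) - ρ (lam x)) - (ρ (lam (x + e ν)) - ρ (lam x)) * ρ (u₂ ν x)))
    (hc₃ : ∀ ν x, ρ (c₃ ν x) = (ρ (lam x) * ρ (u₃ ν x) - ρ (u₃ ν x) * ρ (lam x)) -
      (2 : ℝ)⁻¹ • (ρ (u₃ ν x) * (ρ (lam (x + e ν)) - ρ (lam x)) - (ρ (lam (x + e ν)) - ρ (lam x)) * ρ (u₃ ν x)))
    (hq₂₃ : ∀ ν x, ρ (q₂₃ ν x) =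
      (12 : ℝ)⁻¹ • ((ρ (u₂ ν x) * (ρ (u₃ ν x) * (ρ (lam (x + e ν)) - ρ (lam x)) - (ρ (lam (x + e ν)) - ρ (lam x)) *
        ρ (u₃ ν x)) - (ρ (u₃ ν x) * (ρ (lam (x + e ν)) - ρ (lam x)) - (ρ (lam (x + e ν)) - ρ (lam x)) * ρ (u₃ ν x))
        * ρ (u₂ ν x)) + (ρ (u₃ ν x) * (ρ (u₂ ν x) * (ρ (lam (x + e ν)) - ρ (lam x)) - (ρ (lam (x + e ν)) -
        ρ (lam x)) * ρ (u₂ ν x)) - (ρ (u₂ ν x) * (ρ (lam (x + e ν)) - ρ (lam x)) - (ρ (lam (x + e ν)) - ρ (lam x)) *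
        ρ (u₂ ν x)) * ρ (u₃ ν x))))
    (hq₁₃ : ∀ ν x, ρ (q₁₃ ν x) =
      (12 : ℝ)⁻¹ • ((ρ (u₁ ν x) * (ρ (u₃ ν x) * (ρ (lam (x + e ν)) - ρ (lam x)) - (ρ (lam (x + e ν)) - ρ (lam x)) *
        ρ (u₃ ν x)) - (ρ (u₃ ν x) * (ρ (lam (x + e ν)) - ρ (lam x)) - (ρ (lam (x + e ν)) - ρ (lam x)) * ρ (u₃ ν x))
        * ρ (u₁ ν x)) + (ρ (u₃ ν x) * (ρ (u₁ ν x) * (ρ (lam (x + e ν)) - ρ (lam x)) - (ρ (lam (x + e ν)) -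
        ρ (lam x)) * ρ (u₁ ν x)) - (ρ (u₁ ν x) * (ρ (lam (x + e ν)) - ρ (lam x)) - (ρ (lam (x + e ν)) - ρ (lam x)) *
        ρ (u₁ ν x)) * ρ (u₃ ν x))))
    (hq₁₂ : ∀ ν x, ρ (q₁₂ ν x) =
      (12 : ℝ)⁻¹ • ((ρ (u₁ ν x) * (ρ (u₂ ν x) * (ρ (lam (x + e ν)) - ρ (lam x)) - (ρ (lam (x + e ν)) - ρ (lam x)) *
        ρ (u₂ ν x)) - (ρ (u₂ ν x) * (ρ (lam (x + e ν)) - ρ (lam x)) - (ρ (lam (x + e ν)) - ρ (lam x)) * ρ (u₂ ν x))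
        * ρ (u₁ ν x)) + (ρ (u₂ ν x) * (ρ (u₁ ν x) * (ρ (lam (x + e ν)) - ρ (lam x)) - (ρ (lam (x + e ν)) -
        ρ (lam x)) * ρ (u₁ ν x)) - (ρ (u₁ ν x) * (ρ (lam (x + e ν)) - ρ (lam x)) - (ρ (lam (x + e ν)) - ρ (lam x)) *
        ρ (u₁ ν x)) * ρ (u₂ ν x)))) :
    fderiv ℝ (fderiv ℝ (fderiv ℝ (fderiv ℝ (fun B : Λ → T → V => ℰ (fun ν x => exp (ρ (B ν x))))))) 0 u₁ u₂ u₃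
        (fun ν y => lam (y + e ν) - lam y)
      - fderiv ℝ (fderiv ℝ (fderiv ℝ (fun B : Λ → T → V => ℰ (fun ν x => exp (ρ (B ν x)))))) 0 u₁ u₂ c₃
      - fderiv ℝ (fderiv ℝ (fderiv ℝ (fun B : Λ → T → V => ℰ (fun ν x => exp (ρ (B ν x)))))) 0 u₁ u₃ c₂
      - fderiv ℝ (fderiv ℝ (fderiv ℝ (fun B : Λ → T → V => ℰ (fun ν x => exp (ρ (B ν x)))))) 0 u₂ u₃ c₁
      + fderiv ℝ (fderiv ℝ (fun B : Λ → T → V => ℰ (fun ν x => exp (ρ (B ν x))))) 0 u₁ q₂₃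
      + fderiv ℝ (fderiv ℝ (fun B : Λ → T → V => ℰ (fun ν x => exp (ρ (B ν x))))) 0 u₂ q₁₃
      + fderiv ℝ (fderiv ℝ (fun B : Λ → T → V => ℰ (fun ν x => exp (ρ (B ν x))))) 0 u₃ q₁₂ = 0 := by
  have hℰ3 : ContDiffAt ℝ 3 ℰ 1 := hℰ.of_le (by norm_num)
  have hℰ2 : ContDiffAt ℝ 2 ℰ 1 := hℰ.of_le (by norm_num)
  rw [fderiv_fderiv_fderiv_fderiv_comp_chart_zero_apply ρ hℰ, fderiv_fderiv_fderiv_comp_chart_zero_apply ρ hℰ3,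
    fderiv_fderiv_fderiv_comp_chart_zero_apply ρ hℰ3, fderiv_fderiv_fderiv_comp_chart_zero_apply ρ hℰ3,
    fderiv_fderiv_comp_chart_zero_apply ρ hℰ2, fderiv_fderiv_comp_chart_zero_apply ρ hℰ2,
    fderiv_fderiv_comp_chart_zero_apply ρ hℰ2]
  simp only [map_sub]
  rw [fourth_one_apply_grad_eq e hℰ (fun x => ρ (lam x)) h47,
    third_one_apply_grad_eq e hℰ3 (fun x => ρ (lam x)) h47, third_one_apply_grad_eq e hℰ3 (fun x => ρ (lam x)) h47,
    third_one_apply_grad_eq e hℰ3 (fun x => ρ (lam x)) h47, hessian_one_apply_grad_eq e hℰ2 (fun x => ρ (lam x)) h47]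
  -- the stand-alone `ρc` slots: generator term + Jordan term (as in the parent's `third_chart_apply_grad_eq`)
  have hc₁' : (fun ν x => ρ (c₁ ν x)) = (fun ν x => ρ (lam x) * ρ (u₁ ν x) - ρ (u₁ ν x) * ρ (lam (x + e ν))) +
      fun ν x => (2 : ℝ)⁻¹ • (ρ (u₁ ν x) * (ρ (lam (x + e ν)) - ρ (lam x)) +
        (ρ (lam (x + e ν)) - ρ (lam x)) * ρ (u₁ ν x)) := by
    funext ν x
    simp only [Pi.add_apply]
    rw [hc₁ ν x]
    exact (gen_add_jordan_eq_commutator_sub _ _ _).symm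
  have hc₂' : (fun ν x => ρ (c₂ ν x)) = (fun ν x => ρ (lam x) * ρ (u₂ ν x) - ρ (u₂ ν x) * ρ (lam (x + e ν))) +
      fun ν x => (2 : ℝ)⁻¹ • (ρ (u₂ ν x) * (ρ (lam (x + e ν)) - ρ (lam x)) +
        (ρ (lam (x + e ν)) - ρ (lam x)) * ρ (u₂ ν x)) := by
    funext ν x
    simp only [Pi.add_apply]
    rw [hc₂ ν x]
    exact (gen_add_jordan_eq_commutator_sub _ _ _).symm
  have hc₃' : (fun ν x => ρ (c₃ ν x)) = (fun ν x => ρ (lam x) * ρ (u₃ ν x) - ρ (u₃ ν x) * ρ (lam (x + e ν))) +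
      fun ν x => (2 : ℝ)⁻¹ • (ρ (u₃ ν x) * (ρ (lam (x + e ν)) - ρ (lam x)) +
        (ρ (lam (x + e ν)) - ρ (lam x)) * ρ (u₃ ν x)) := by
    funext ν x
    simp only [Pi.add_apply]
    rw [hc₃ ν x]
    exact (gen_add_jordan_eq_commutator_sub _ _ _).symm
  rw [hc₃', hc₂', hc₁']
  simp only [map_add]
  simp only [hc₁, hc₂, hc₃, hq₂₃, hq₁₃, hq₁₂]
  apply comb4
  · -- the `D²𝐄(1)(ρu₁, ·)`-slot
    rw [← map_add, ← map_sub, ← map_sub, ← map_add]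
    refine (congrArg _ ?_).trans (map_zero _)
    funext ν x
    simp only [Pi.add_apply, Pi.sub_apply, Pi.zero_apply]
    exact residual3_eq_zero _ _ _ _
  · -- the `D²𝐄(1)(ρu₂, ·)`-slot
    rw [← map_add, ← map_sub, ← map_sub, ← map_add]
    refine (congrArg _ ?_).trans (map_zero _)
    funext ν x
    simp only [Pi.add_apply, Pi.sub_apply, Pi.zero_apply]
    exact residual3_eq_zero _ _ _ _
  · -- the `D²𝐄(1)(ρu₃, ·)`-slot
    rw [← map_add, ← map_sub, ← map_sub, ← map_add]
    refine (congrArg _ ?_).trans (map_zero _)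
    funext ν x
    simp only [Pi.add_apply, Pi.sub_apply, Pi.zero_apply]
    exact residual3_eq_zero _ _ _ _
  · -- the `D𝐄(1)`-slot (`k₃ = 0`)
    rw [← map_add, ← map_sub, ← map_sub, ← map_sub, ← map_add, ← map_add, ← map_add]
    refine (congrArg _ ?_).trans (map_zero _)
    funext ν x
    simp only [Pi.add_apply, Pi.sub_apply, Pi.zero_apply]
    exact residual4_eq_zero _ _ _ _ _

end FourFifteenThree

/-! ## §6. Print's literal slot orders; the variations built from a bracket; the corollary (4.24) of p. 287 -/

section SlotSymmetry

variable {E F : Type*} [NormedAddCommGroup E] [NormedSpace ℝ E] [NormedAddCommGroup F] [NormedSpace ℝ F]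

/-- `D³f(x)(u, v, w) = D³f(x)(v, u, w)` for `f` `C³` at `x` (symmetry of the Hessian of `Df`). [folklore] -/
theorem fderiv_fderiv_fderiv_apply_swap_left {f : E → F} {x : E} (hf : ContDiffAt ℝ 3 f x) (u v w : E) :
    fderiv ℝ (fderiv ℝ (fderiv ℝ f)) x u v w = fderiv ℝ (fderiv ℝ (fderiv ℝ f)) x v u w := by
  have hg : ContDiffAt ℝ 2 (fderiv ℝ f) x := hf.fderiv_right (by norm_num)
  rw [(hg.isSymmSndFDerivAt (by simp)).eq u v]

/-- `D³f(x)(u, v, w) = D³f(x)(u, w, v)` for `f` `C³` at `x` (the Hessian is symmetric NEAR `x`; differentiate).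
[folklore] -/
theorem fderiv_fderiv_fderiv_apply_swap_right {f : E → F} {x : E} (hf : ContDiffAt ℝ 3 f x) (u v w : E) :
    fderiv ℝ (fderiv ℝ (fderiv ℝ f)) x u v w = fderiv ℝ (fderiv ℝ (fderiv ℝ f)) x u w v := by
  have hnear : ∀ᶠ y in 𝓝 x, ContDiffAt ℝ 3 f y := hf.eventually (by simp)
  have hsymm : (fun y => fderiv ℝ (fderiv ℝ f) y v w) =ᶠ[𝓝 x] fun y => fderiv ℝ (fderiv ℝ f) y w v :=
    hnear.mono fun y hy => (hy.isSymmSndFDerivAt (le_trans (by simp : minSmoothness ℝ 2 ≤ 2) (by norm_num))).eq v w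
  have hA : DifferentiableAt ℝ (fderiv ℝ (fderiv ℝ f)) x :=
    ((hf.fderiv_right (m := 2) (by norm_num)).fderiv_right (m := 1) (by norm_num)).differentiableAt (by norm_num)
  have key : ∀ v w : E, fderiv ℝ (fderiv ℝ (fderiv ℝ f)) x u v w =
      fderiv ℝ (fun y => fderiv ℝ (fderiv ℝ f) y v w) x u := by
    intro v w
    have hA' : DifferentiableAt ℝ (fun y => fderiv ℝ (fderiv ℝ f) y v) x :=
      DifferentiableAt.clm_apply (c := fderiv ℝ (fderiv ℝ f)) (u := fun _ : E => v) hA (differentiableAt_const v)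
    rw [fderiv_eval_const (A := fun y => fderiv ℝ (fderiv ℝ f) y v) hA' w u,
      fderiv_eval_const (A := fderiv ℝ (fderiv ℝ f)) hA v u]
  rw [key v w, key w v, hsymm.fderiv_eq]

end SlotSymmetry

section Corollaries

variable {𝔄 : Type*} [NormedRing 𝔄] [NormedAlgebra ℝ 𝔄] [CompleteSpace 𝔄] {Λ T : Type*} [Fintype Λ] [Fintype T]
  [AddCommGroup T] {V : Type*} [NormedAddCommGroup V] [NormedSpace ℝ V] {F : Type*} [NormedAddCommGroup F]
  [NormedSpace ℝ F]

omit [AddCommGroup T] in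
/-- The chart functional `B ↦ 𝐄(exp iρB)` is `C³` at `B = 0` if `𝐄` is `C³` at `1`. [folklore] -/
theorem contDiffAt_three_comp_chart {ℰ : (Λ → T → 𝔄) → F} (ρ : V →L[ℝ] 𝔄) (hℰ : ContDiffAt ℝ 3 ℰ 1) :
    ContDiffAt ℝ 3 (fun B : Λ → T → V => ℰ (fun ν x => exp (ρ (B ν x)))) 0 := by
  have h : ContDiffAt ℝ 3 ℰ ((fun B : Λ → T → V => fun ν x => exp (ρ (B ν x))) 0) := by
    rw [show ((fun B : Λ → T → V => fun ν x => exp (ρ (B ν x))) 0) = 1 from chart_zero ρ]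
    exact hℰ
  exact h.comp 0 (contDiff_chart ρ).contDiffAt

-- (the quadruply nested operator space over the iterated `Pi` type: one more level of pending instance synthesis)
set_option maxSynthPendingDepth 3 in
/-- **(4.15)₃ at `B = 0` in the chart, IN PRINT'S LITERAL SLOT ORDERS** (p. 284 (4.15), third identity:
«⟨(δ⁴/δB⁴)𝐄(1), B₁, B₂, B₃, ∂λ⟩ − ⟨(δ³/δB³)𝐄(1), B₁, B₂, i[λ₋, B₃] − ½i[B₃, ∂λ]⟩ − (B₃↔B₂) − (B₃↔B₁) +
⟨(δ²/δB²)𝐄(1), B₁, k₂{iad_{B₂}, iad_{B₃}}∂λ⟩ + (B₁↔B₂) + (B₁↔B₃) = 0, […] for an arbitrary gauge function λ, and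
arbitrary gauge fields B₁, B₂, B₃.»): the exchanged terms written exactly as the exchange symbol produces them —
`⟨𝐄⁽³⁾, B₃, B₂, c_{B₁}⟩` and `⟨𝐄⁽²⁾, B₃, k₂{iad_{B₂}, iad_{B₁}}∂λ⟩` (`hq₂₁`: the anticommutator in the order
`B₂, B₁`) — from `fourth_chart_apply_grad_eq_zero` and the symmetry of `D³f(0)`.
[cite: Balaban1987RG1, (4.7) p.282, (4.12) p.284, (4.15) p.284] -/
theorem fourth_chart_apply_grad_eq_zero_literal {ℰ : (Λ → T → 𝔄) → F} (e : Λ → T) (ρ : V →L[ℝ] 𝔄)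
    (hℰ : ContDiffAt ℝ 4 ℰ 1) (lam : T → V) (h47 : ∀ᶠ W in 𝓝 (1 : Λ → T → 𝔄), ∀ᶠ t in 𝓝 (0 : ℝ),
      ℰ (fun ν x => exp (t • ρ (lam x)) * W ν x * exp (-(t • ρ (lam (x + e ν))))) = ℰ W)
    (u₁ u₂ u₃ c₁ c₂ c₃ q₂₃ q₁₃ q₂₁ : Λ → T → V)
    (hc₁ : ∀ ν x, ρ (c₁ ν x) = (ρ (lam x) * ρ (u₁ ν x) - ρ (u₁ ν x) * ρ (lam x)) -
      (2 : ℝ)⁻¹ • (ρ (u₁ ν x) * (ρ (lam (x + e ν)) - ρ (lam x)) - (ρ (lam (x + e ν)) - ρ (lam x)) * ρ (u₁ ν x)))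
    (hc₂ : ∀ ν x, ρ (c₂ ν x) = (ρ (lam x) * ρ (u₂ ν x) - ρ (u₂ ν x) * ρ (lam x)) -
      (2 : ℝ)⁻¹ • (ρ (u₂ ν x) * (ρ (lam (x + e ν)) - ρ (lam x)) - (ρ (lam (x + e ν)) - ρ (lam x)) * ρ (u₂ ν x)))
    (hc₃ : ∀ ν x, ρ (c₃ ν x) = (ρ (lam x) * ρ (u₃ ν x) - ρ (u₃ ν x) * ρ (lam x)) -
      (2 : ℝ)⁻¹ • (ρ (u₃ ν x) * (ρ (lam (x + e ν)) - ρ (lam x)) - (ρ (lam (x + e ν)) - ρ (lam x)) * ρ (u₃ ν x)))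
    (hq₂₃ : ∀ ν x, ρ (q₂₃ ν x) =
      (12 : ℝ)⁻¹ • ((ρ (u₂ ν x) * (ρ (u₃ ν x) * (ρ (lam (x + e ν)) - ρ (lam x)) - (ρ (lam (x + e ν)) - ρ (lam x)) *
        ρ (u₃ ν x)) - (ρ (u₃ ν x) * (ρ (lam (x + e ν)) - ρ (lam x)) - (ρ (lam (x + e ν)) - ρ (lam x)) * ρ (u₃ ν x))
        * ρ (u₂ ν x)) + (ρ (u₃ ν x) * (ρ (u₂ ν x) * (ρ (lam (x + e ν)) - ρ (lam x)) - (ρ (lam (x + e ν)) -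
        ρ (lam x)) * ρ (u₂ ν x)) - (ρ (u₂ ν x) * (ρ (lam (x + e ν)) - ρ (lam x)) - (ρ (lam (x + e ν)) - ρ (lam x)) *
        ρ (u₂ ν x)) * ρ (u₃ ν x))))
    (hq₁₃ : ∀ ν x, ρ (q₁₃ ν x) =
      (12 : ℝ)⁻¹ • ((ρ (u₁ ν x) * (ρ (u₃ ν x) * (ρ (lam (x + e ν)) - ρ (lam x)) - (ρ (lam (x + e ν)) - ρ (lam x)) *
        ρ (u₃ ν x)) - (ρ (u₃ ν x) * (ρ (lam (x + e ν)) - ρ (lam x)) - (ρ (lam (x + e ν)) - ρ (lam x)) * ρ (u₃ ν x))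
        * ρ (u₁ ν x)) + (ρ (u₃ ν x) * (ρ (u₁ ν x) * (ρ (lam (x + e ν)) - ρ (lam x)) - (ρ (lam (x + e ν)) -
        ρ (lam x)) * ρ (u₁ ν x)) - (ρ (u₁ ν x) * (ρ (lam (x + e ν)) - ρ (lam x)) - (ρ (lam (x + e ν)) - ρ (lam x)) *
        ρ (u₁ ν x)) * ρ (u₃ ν x))))
    (hq₂₁ : ∀ ν x, ρ (q₂₁ ν x) =
      (12 : ℝ)⁻¹ • ((ρ (u₂ ν x) * (ρ (u₁ ν x) * (ρ (lam (x + e ν)) - ρ (lam x)) - (ρ (lam (x + e ν)) - ρ (lam x)) *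
        ρ (u₁ ν x)) - (ρ (u₁ ν x) * (ρ (lam (x + e ν)) - ρ (lam x)) - (ρ (lam (x + e ν)) - ρ (lam x)) * ρ (u₁ ν x))
        * ρ (u₂ ν x)) + (ρ (u₁ ν x) * (ρ (u₂ ν x) * (ρ (lam (x + e ν)) - ρ (lam x)) - (ρ (lam (x + e ν)) -
        ρ (lam x)) * ρ (u₂ ν x)) - (ρ (u₂ ν x) * (ρ (lam (x + e ν)) - ρ (lam x)) - (ρ (lam (x + e ν)) - ρ (lam x)) *
        ρ (u₂ ν x)) * ρ (u₁ ν x)))) :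
    fderiv ℝ (fderiv ℝ (fderiv ℝ (fderiv ℝ (fun B : Λ → T → V => ℰ (fun ν x => exp (ρ (B ν x))))))) 0 u₁ u₂ u₃
        (fun ν y => lam (y + e ν) - lam y)
      - fderiv ℝ (fderiv ℝ (fderiv ℝ (fun B : Λ → T → V => ℰ (fun ν x => exp (ρ (B ν x)))))) 0 u₁ u₂ c₃
      - fderiv ℝ (fderiv ℝ (fderiv ℝ (fun B : Λ → T → V => ℰ (fun ν x => exp (ρ (B ν x)))))) 0 u₁ u₃ c₂
      - fderiv ℝ (fderiv ℝ (fderiv ℝ (fun B : Λ → T → V => ℰ (fun ν x => exp (ρ (B ν x)))))) 0 u₃ u₂ c₁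
      + fderiv ℝ (fderiv ℝ (fun B : Λ → T → V => ℰ (fun ν x => exp (ρ (B ν x))))) 0 u₁ q₂₃
      + fderiv ℝ (fderiv ℝ (fun B : Λ → T → V => ℰ (fun ν x => exp (ρ (B ν x))))) 0 u₂ q₁₃
      + fderiv ℝ (fderiv ℝ (fun B : Λ → T → V => ℰ (fun ν x => exp (ρ (B ν x))))) 0 u₃ q₂₁ = 0 := by
  have hf := contDiffAt_three_comp_chart (Λ := Λ) (T := T) ρ (hℰ.of_le (by norm_num))
  rw [fderiv_fderiv_fderiv_apply_swap_left hf u₃ u₂ c₁]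
  exact fourth_chart_apply_grad_eq_zero e ρ hℰ lam h47 u₁ u₂ u₃ c₁ c₂ c₃ q₂₃ q₁₃ q₂₁ hc₁ hc₂ hc₃ hq₂₃ hq₁₃
    (fun ν x => (hq₂₁ ν x).trans (congrArg _ (add_comm _ _)))

-- (the quadruply nested operator space over the iterated `Pi` type: one more level of pending instance synthesis)
set_option maxSynthPendingDepth 3 in
/-- **(4.15)₃ at `B = 0` in the chart, the variations BUILT FROM A BRACKET**: for any `br : V → V → V` represented by
the commutator (`hbr : ρ(br a b) = ρa ρb − ρb ρa`; e.g. a Lie bracket on `𝔤` with `ρ` a representation), print's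
`i[λ₋, Bᵢ] − ½i[Bᵢ, ∂λ]` is `br(λ(x), Bᵢ) − ½ br(Bᵢ, ∂λ)` and `k₂{iad_{Bᵢ}, iad_{Bⱼ}}∂λ` is
`(1/12)(br(Bᵢ, br(Bⱼ, ∂λ)) + br(Bⱼ, br(Bᵢ, ∂λ)))`, bondwise. [cite: Balaban1987RG1, (4.12) p.284, (4.15) p.284] -/
theorem fourth_chart_apply_grad_eq_zero_of_bracket {ℰ : (Λ → T → 𝔄) → F} (e : Λ → T) (ρ : V →L[ℝ] 𝔄)
    (hℰ : ContDiffAt ℝ 4 ℰ 1) (lam : T → V) (h47 : ∀ᶠ W in 𝓝 (1 : Λ → T → 𝔄), ∀ᶠ t in 𝓝 (0 : ℝ),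
      ℰ (fun ν x => exp (t • ρ (lam x)) * W ν x * exp (-(t • ρ (lam (x + e ν))))) = ℰ W)
    (br : V → V → V) (hbr : ∀ a b, ρ (br a b) = ρ a * ρ b - ρ b * ρ a) (u₁ u₂ u₃ : Λ → T → V) :
    fderiv ℝ (fderiv ℝ (fderiv ℝ (fderiv ℝ (fun B : Λ → T → V => ℰ (fun ν x => exp (ρ (B ν x))))))) 0 u₁ u₂ u₃
        (fun ν y => lam (y + e ν) - lam y)
      - fderiv ℝ (fderiv ℝ (fderiv ℝ (fun B : Λ → T → V => ℰ (fun ν x => exp (ρ (B ν x)))))) 0 u₁ u₂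
          (fun ν x => br (lam x) (u₃ ν x) - (2 : ℝ)⁻¹ • br (u₃ ν x) (lam (x + e ν) - lam x))
      - fderiv ℝ (fderiv ℝ (fderiv ℝ (fun B : Λ → T → V => ℰ (fun ν x => exp (ρ (B ν x)))))) 0 u₁ u₃
          (fun ν x => br (lam x) (u₂ ν x) - (2 : ℝ)⁻¹ • br (u₂ ν x) (lam (x + e ν) - lam x))
      - fderiv ℝ (fderiv ℝ (fderiv ℝ (fun B : Λ → T → V => ℰ (fun ν x => exp (ρ (B ν x)))))) 0 u₂ u₃
          (fun ν x => br (lam x) (u₁ ν x) - (2 : ℝ)⁻¹ • br (u₁ ν x) (lam (x + e ν) - lam x))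
      + fderiv ℝ (fderiv ℝ (fun B : Λ → T → V => ℰ (fun ν x => exp (ρ (B ν x))))) 0 u₁
          (fun ν x => (12 : ℝ)⁻¹ • (br (u₂ ν x) (br (u₃ ν x) (lam (x + e ν) - lam x)) +
            br (u₃ ν x) (br (u₂ ν x) (lam (x + e ν) - lam x))))
      + fderiv ℝ (fderiv ℝ (fun B : Λ → T → V => ℰ (fun ν x => exp (ρ (B ν x))))) 0 u₂
          (fun ν x => (12 : ℝ)⁻¹ • (br (u₁ ν x) (br (u₃ ν x) (lam (x + e ν) - lam x)) +
            br (u₃ ν x) (br (u₁ ν x) (lam (x + e ν) - lam x))))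
      + fderiv ℝ (fderiv ℝ (fun B : Λ → T → V => ℰ (fun ν x => exp (ρ (B ν x))))) 0 u₃
          (fun ν x => (12 : ℝ)⁻¹ • (br (u₁ ν x) (br (u₂ ν x) (lam (x + e ν) - lam x)) +
            br (u₂ ν x) (br (u₁ ν x) (lam (x + e ν) - lam x)))) = 0 :=
  fourth_chart_apply_grad_eq_zero e ρ hℰ lam h47 u₁ u₂ u₃ _ _ _ _ _ _
    (fun ν x => by simp only [map_sub, map_smul, hbr]) (fun ν x => by simp only [map_sub, map_smul, hbr])
    (fun ν x => by simp only [map_sub, map_smul, hbr]) (fun ν x => by simp only [map_sub, map_smul, map_add, hbr])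
    (fun ν x => by simp only [map_sub, map_smul, map_add, hbr]) (fun ν x => by simp only [map_sub, map_smul, map_add, hbr])

-- (the quadruply nested operator space over the iterated `Pi` type: one more level of pending instance synthesis)
set_option maxSynthPendingDepth 3 in
/-- **(4.24), p. 287** — p. 286: «The first sum can be written as ⟨𝐄⁽⁴⁾, δB, B, B, ∂λ_x⟩, where we have indicated the
dependence on x explicitly. We apply the third identity in (4.15) taking into acount [sic] the special role of the
first variable x. It is simplest to differentiate this identity with respect to B₁, take B₂ = B₃ = B, λ = λ_x, and
then multiply by δB(x) and sum over x.»  p. 287: «We get ⟨𝐄⁽⁴⁾, δB, B, B, ∂λ_x⟩ = 2⟨𝐄⁽³⁾, δB, B, i[λ_x, B] − ½i[B,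
∂λ_x]⟩ + ⟨𝐄⁽³⁾, i[λ_x, δB] − ½i[δB, ∂λ_x], B, B⟩ − 2⟨𝐄⁽²⁾, δB, k₂(iad_B)²∂λ_x⟩ − 2⟨𝐄⁽²⁾, k₂{iad_B, iad_{δB}}∂λ_x, B⟩.
(4.24)».  The POINTWISE (fixed `x`, before «multiply by δB(x) and sum over x») identity, for the chart functional at
`B = 0` (print's `𝐄⁽ᵏ⁾ = (δᵏ/δBᵏ)𝐄(1)`), with print's coefficients `2, 1, −2, −2` and slot orders: (4.15)₃ with
`B₁ = δB`, `B₂ = B₃ = B`, `λ = λ_x`, `{iad_B, iad_B} = 2(iad_B)²` and the symmetry of `D³f(0)`, `D²f(0)`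
(`hq'`: `ρq' = (1/12)[ρB, [ρB, ρ∂λ]]` represents `k₂(iad_B)²∂λ_x`; `hq''`: `k₂{iad_B, iad_{δB}}∂λ_x` in print's order).
[cite: Balaban1987RG1, (4.15) p.284, p.286, (4.24) p.287] -/
theorem fourth_chart_apply_diag_eq {ℰ : (Λ → T → 𝔄) → F} (e : Λ → T) (ρ : V →L[ℝ] 𝔄)
    (hℰ : ContDiffAt ℝ 4 ℰ 1) (lam : T → V) (h47 : ∀ᶠ W in 𝓝 (1 : Λ → T → 𝔄), ∀ᶠ t in 𝓝 (0 : ℝ),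
      ℰ (fun ν x => exp (t • ρ (lam x)) * W ν x * exp (-(t • ρ (lam (x + e ν))))) = ℰ W)
    (d b cd cb q' q'' : Λ → T → V)
    (hcd : ∀ ν x, ρ (cd ν x) = (ρ (lam x) * ρ (d ν x) - ρ (d ν x) * ρ (lam x)) -
      (2 : ℝ)⁻¹ • (ρ (d ν x) * (ρ (lam (x + e ν)) - ρ (lam x)) - (ρ (lam (x + e ν)) - ρ (lam x)) * ρ (d ν x)))
    (hcb : ∀ ν x, ρ (cb ν x) = (ρ (lam x) * ρ (b ν x) - ρ (b ν x) * ρ (lam x)) -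
      (2 : ℝ)⁻¹ • (ρ (b ν x) * (ρ (lam (x + e ν)) - ρ (lam x)) - (ρ (lam (x + e ν)) - ρ (lam x)) * ρ (b ν x)))
    (hq' : ∀ ν x, ρ (q' ν x) =
      (12 : ℝ)⁻¹ • (ρ (b ν x) * (ρ (b ν x) * (ρ (lam (x + e ν)) - ρ (lam x)) - (ρ (lam (x + e ν)) - ρ (lam x)) *
        ρ (b ν x)) - (ρ (b ν x) * (ρ (lam (x + e ν)) - ρ (lam x)) - (ρ (lam (x + e ν)) - ρ (lam x)) * ρ (b ν x)) *
        ρ (b ν x)))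
    (hq'' : ∀ ν x, ρ (q'' ν x) =
      (12 : ℝ)⁻¹ • ((ρ (b ν x) * (ρ (d ν x) * (ρ (lam (x + e ν)) - ρ (lam x)) - (ρ (lam (x + e ν)) - ρ (lam x)) *
        ρ (d ν x)) - (ρ (d ν x) * (ρ (lam (x + e ν)) - ρ (lam x)) - (ρ (lam (x + e ν)) - ρ (lam x)) * ρ (d ν x)) *
        ρ (b ν x)) + (ρ (d ν x) * (ρ (b ν x) * (ρ (lam (x + e ν)) - ρ (lam x)) - (ρ (lam (x + e ν)) - ρ (lam x)) *
        ρ (b ν x)) - (ρ (b ν x) * (ρ (lam (x + e ν)) - ρ (lam x)) - (ρ (lam (x + e ν)) - ρ (lam x)) * ρ (b ν x)) *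
        ρ (d ν x)))) :
    fderiv ℝ (fderiv ℝ (fderiv ℝ (fderiv ℝ (fun B : Λ → T → V => ℰ (fun ν x => exp (ρ (B ν x))))))) 0 d b b
        (fun ν y => lam (y + e ν) - lam y) =
      (2 : ℝ) • fderiv ℝ (fderiv ℝ (fderiv ℝ (fun B : Λ → T → V => ℰ (fun ν x => exp (ρ (B ν x)))))) 0 d b cb
      + fderiv ℝ (fderiv ℝ (fderiv ℝ (fun B : Λ → T → V => ℰ (fun ν x => exp (ρ (B ν x)))))) 0 cd b b
      - (2 : ℝ) • fderiv ℝ (fderiv ℝ (fun B : Λ → T → V => ℰ (fun ν x => exp (ρ (B ν x))))) 0 d q'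
      - (2 : ℝ) • fderiv ℝ (fderiv ℝ (fun B : Λ → T → V => ℰ (fun ν x => exp (ρ (B ν x))))) 0 q'' b := by
  have hf := contDiffAt_three_comp_chart (Λ := Λ) (T := T) ρ (hℰ.of_le (by norm_num))
  have h := fourth_chart_apply_grad_eq_zero e ρ hℰ lam h47 d b b cd cb cb (q' + q') q'' q'' hcd hcb hcb
    (fun ν x => by rw [Pi.add_apply, Pi.add_apply, map_add, hq', ← smul_add])
    (fun ν x => (hq'' ν x).trans (congrArg _ (add_comm _ _)))
    (fun ν x => (hq'' ν x).trans (congrArg _ (add_comm _ _)))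
  rw [map_add, fderiv_fderiv_fderiv_apply_swap_right hf b b cd, fderiv_fderiv_fderiv_apply_swap_left hf b cd b,
    hessian_chart_symm ρ (hℰ.of_le (by norm_num)) b q''] at h
  rw [← sub_eq_zero, ← h]
  simp only [two_smul]
  abel

end Corollaries

end Literature.MathematicalPhysics.QuantumFieldTheory.Balaban1983to89.B12WardThird415
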